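import Summits.CriticalPhenomena.PercolationContinuityZ3.Theorems.Transplant.SkelPhiRootNumbersY6
import Summits.CriticalPhenomena.PercolationContinuityZ3.Theorems.Transplant.SkelPhiRootNegBY
import Summits.CriticalPhenomena.PercolationContinuityZ3.Theorems.Transplant.SkelPhiRootNegBKit
import Summits.CriticalPhenomena.PercolationContinuityZ3.Theorems.Transplant.SkelPhiRootDiam
import Summits.CriticalPhenomena.PercolationContinuityZ3.Theorems.Transplant.SkelNegBParamsSlotsS
import Summits.CriticalPhenomena.PercolationContinuityZ3.Theorems.Transplant.SkelPhiRootRoomsB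
import Summits.CriticalPhenomena.PercolationContinuityZ3.Theorems.Transplant.SkelPhiRootServe
import Summits.CriticalPhenomena.PercolationContinuityZ3.Theorems.Transplant.SkelPhiRootServeTable
import Summits.CriticalPhenomena.PercolationContinuityZ3.Theorems.Transplant.SkelPhiCylRadOri
import Summits.CriticalPhenomena.PercolationContinuityZ3.Theorems.Transplant.SkelNegBChoiceAllT
import Summits.CriticalPhenomena.PercolationContinuityZ3.Theorems.Transplant.SkelNegBParamsSlotsRS
import Summits.CriticalPhenomena.PercolationContinuityZ3.Theorems.Transplant.SkelNegBParamsSlots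
import Summits.CriticalPhenomena.PercolationContinuityZ3.Theorems.Transplant.SkelNegBParamsExcess
import Summits.CriticalPhenomena.PercolationContinuityZ3.Theorems.Transplant.SkelPhiConcFaceRoute
import HarnessLib

/-!
# N1 (the `{±1}` node), (R) column ((R6c), VERTICAL directions, NEG-SCOPE B.17 y′-family v3): **THE ROOT RESIDUE OF THE S1 CHOICES OF RECORD AT A VERTICAL DIRECTION,
# FROM `AtQO`, THREE LEGS** — `Skel.RootOblTWAt G ((choiceAt… …).scheme O q) Φ.Δ κ.δr du` by `Skelφ.rootOblTWAt_of_numbers6_y` (hop of side `σu` → bridge → x-run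
# prefix `xRunSched n_L ℓ_L h_L RA′ q_X N_x` → y′-run `yRunSched … RA′ q_Y N_y` of vertical sign `sgOf du`), everything structural discharged from the ledger as in the
# x-family's `rootOblTWAt_negBS3_x` (+ the y′-run's kit table `real_pexYO_gt` and long top pieces).  HYPOTHESES LEFT (stmt-g14): hop side `σu` (ruling B.17:
# `σu := sgOf du · sgn⁺ v_L`), slots `mk Nx qX Ny qY Rπ Rb yX yY mx`, bridge data `B Qb Fb`, root radii, `hΛRg`, `hclrz`, and INTEGER INEQUALITIES (x-prefix rooms = the
# x-family's minus its target box; y′-leg: PER-REGION boxes `k ↦ [qbLo k, qbHi k] × [qaLo k, qaHi k]` + readings (hp-8 g33: a drifting run's prism hull over-reads), last-core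
# box, `hclrY`, `hx₂₃`, `hπ3`).  Located (L-R4), lane INBOX 2026-08-21T19:47Z.

builds on p205010 (kernel theorem, internal audit signed; external expert review pending) — nothing in this file uses p205010; NOTHING is claimed about the open node
`SamePDropOfSkeletonNeg₁`: this is the (R) residue of `samePDropOfSkeletonNeg₁_of_choiceFnNOW` at the vertical directions modulo the listed numbers.
Lane `prim-bschramm`, seat `prim-bschramm-p3` (gen 10; design owner + (R) owner); helper file (`--supports stmt-CriticalPhenomena-4575 --as helper`).
[cite: KozmaNitzan2024, §4 Theorem 6 (pp. 25–31), p. 28 ((32) at the root), Lemma 10–12] [cite: MartineauTassion2017, §3.2, §4.3]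
-/

noncomputable section

open scoped Classical

namespace Summit.CriticalPhenomena.PercolationContinuityZ3.Theorems.Transplant

open MeasureTheory Literature.Probability.Percolation Literature.Probability.LatticeModels SimpleGraph KNCells KNLevels
open Literature.Probability.Percolation.KozmaNitzan.Cells (oth sgOf sgOf_sign stepVec_apply_fst)
open Literature.Barriers.CriticalPhenomena (graphBall mem_graphBall_self graphBall_mono)
open BoxProdZ2 (ConcRadiiG)

namespace PlanarSkeletonNeg

open SkelConc (Consts)
open Skelφ (oriφ trφ FootBox rootFrame runX runY xRunSched yRunSched yPrmW RgO pexRO pexXO pexYO ShortPcO shearUnit pgramPrismFin pgSideHalfW pgTopPieceW)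
open Skelφ.StepI (DataN OutO eventNAt)
open ChainPlanar (BridgePrm BridgeOK)
open SkelI (tanOff)

namespace NegB

open Neg

section AtQ

variable {κ : Consts} {V : Type} [DecidableEq V] [Countable V] {G : SimpleGraph V} [G.LocallyFinite] {Φ : PlanarSkeletonNeg G} {t : V} {p : unitInterval}
  {hC : Φ.CylSubcritical p} {gv fv : Neg.FSlot} {Pv : PSlot} {Sv : SSlot} {O : OutO V} {q : unitInterval}

set_option maxHeartbeats 800000 in
/-- **THE ROOT RESIDUE OF THE S1 CHOICES OF RECORD AT A VERTICAL DIRECTION, THREE LEGS** (T-variant of record: `choiceAtOT`, arrival boxes `b0T = r/4`, NEG-SCOPE B.16; see the module docstring).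
[cite: KozmaNitzan2024, §4 p. 28 ((32) at the root), Lemma 10–12 (pp. 17–25)] -/
theorem rootOblTWAt_negBT_y (hAt : (choiceAtOT κ Φ t p gv fv Sv hC Pv).AtQO O q) (h1 : Φ.types = {t}) (hp0 : 0 < (p : ℝ)) (hp1 : (p : ℝ) < 1)
    (du : MDir) {σu : ℤ} (hσu : σu = 1 ∨ σu = -1) (mk Nx qX Ny qY Rπ Rb : ℕ) (hNr : 0 + 1 + Nx + 1 + Ny ≤ 1000) (yX yY : Site 2) (mx : ℕ)
    (hPk : (KS.MK O.merged mk, KS.nKit O.merged mk) ∈ (Pv κ Φ t p O.merged).1)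
    (hRQ : Rπ + 1 ≤ (schedOf κ Φ t p O.merged (gOf κ Φ t p O gv) (fOf κ Φ t p O fv) (Sv κ Φ t p O.merged (gOf κ Φ t p O gv) (fOf κ Φ t p O fv) q)).rQ 0 0)
    (hRB : Rπ + 1 ≤ (schedOf κ Φ t p O.merged (gOf κ Φ t p O gv) (fOf κ Φ t p O fv) (Sv κ Φ t p O.merged (gOf κ Φ t p O gv) (fOf κ Φ t p O fv) q)).rB 0 0 du)
    (hRQ' : Rπ + 1 ≤ (schedOf κ Φ t p O.merged (gOf κ Φ t p O gv) (fOf κ Φ t p O fv) (Sv κ Φ t p O.merged (gOf κ Φ t p O gv) (fOf κ Φ t p O fv) q)).rQ 0 ((0 : Site 2) + stepVec du))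
    (hRM : Rπ + 1 ≤ (schedOf κ Φ t p O.merged (gOf κ Φ t p O gv) (fOf κ Φ t p O fv) (Sv κ Φ t p O.merged (gOf κ Φ t p O gv) (fOf κ Φ t p O fv) q)).rM 0 ((0 : Site 2) + stepVec du))
    (hΛRg : ∀ c, O.merged.Λ c (Mu O.merged) ⊆ KS.RgK G t O.merged mk (KS.φK Φ t O.D O.DT O.ori mk) c)
    {kA : ℤ} (hkA0 : 20 * (((fcells κ Φ t p O.merged (gOf κ Φ t p O gv) (fOf κ Φ t p O fv))).K : ℤ) * (((fcells κ Φ t p O.merged (gOf κ Φ t p O gv) (fOf κ Φ t p O fv))).s 0 : ℤ) * (|(800 : ℤ)| * (|(Skelφ.NegPrm.vβOf (nL κ Φ t p O.merged (gOf κ Φ t p O gv) (fOf κ Φ t p O fv)) (hL κ Φ t p O.merged (gOf κ Φ t p O gv) (fOf κ Φ t p O fv)) (ℓL κ Φ t p O.merged (gOf κ Φ t p O gv) (fOf κ Φ t p O fv)) (vL κ Φ t p O.merged (gOf κ Φ t p O gv) (fOf κ Φ t p O fv)))| + |(vL κ Φ t p O.merged (gOf κ Φ t p O gv) (fOf κ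 Φ t p O fv))|) * (O.merged.k : ℤ)) ≤ kA * (Skelφ.NegPrm.Dof (nL κ Φ t p O.merged (gOf κ Φ t p O gv) (fOf κ Φ t p O fv)) (hL κ Φ t p O.merged (gOf κ Φ t p O gv) (fOf κ Φ t p O fv)) (ℓL κ Φ t p O.merged (gOf κ Φ t p O gv) (fOf κ Φ t p O fv)) (vL κ Φ t p O.merged (gOf κ Φ t p O gv) (fOf κ Φ t p O fv))))
    (hkA1 : 20 * (((fcells κ Φ t p O.merged (gOf κ Φ t p O gv) (fOf κ Φ t p O fv))).K : ℤ) * (((fcells κ Φ t p O.merged (gOf κ Φ t p O gv) (fOf κ Φ t p O fv))).s 1 : ℤ) * (|(800 : ℤ)| * (|(((nL κ Φ t p O.merged (gOf κ Φ t p O gv) (fOf κ Φ t p O fv)) : ℕ) : ℤ)| + |(hL κ Φ t p O.merged (gOf κ Φ t p O gv) (fOf κ Φ t p O fv))|) * (O.merged.k : ℤ)) ≤ kA * (Skelφ.NegPrm.Dof (nL κ Φ t p O.merged (gOf κ Φ t p O gv) (fOf κ Φ t p O fv)) (hL κ Φ t p O.merged (gOf κ Φ t p O gv) (fOf κ Φ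 t p O fv)) (ℓL κ Φ t p O.merged (gOf κ Φ t p O gv) (fOf κ Φ t p O fv)) (vL κ Φ t p O.merged (gOf κ Φ t p O gv) (fOf κ Φ t p O fv))))
    (hkAQ : kA + 1 ≤ 5 * (((fcells κ Φ t p O.merged (gOf κ Φ t p O gv) (fOf κ Φ t p O fv))).r du.1 : ℤ) ∧ kA + 1 ≤ 5 * (((fcells κ Φ t p O.merged (gOf κ Φ t p O gv) (fOf κ Φ t p O fv))).r (oth du.1) : ℤ))
    (hρπ : Skelφ.fatRadius Φ.frame hC O.merged.k ≤ Rπ)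
    (B : BridgePrm) (hB : BridgeOK B) (hBR' : KS.RA' κ Φ t p O.merged mk ≤ B.R')
    (Qb Fb : V → Finset V)
    (hQb : ∀ c, ∀ w ∈ Qb c, w ∈ graphBall G c Rb ∧
      rootFrame (φL κ Φ t p O.D O.DT O.ori (gOf κ Φ t p O gv) (fOf κ Φ t p O fv)) t σu w ∈ Finset.Icc (rootFrame (φL κ Φ t p O.D O.DT O.ori (gOf κ Φ t p O gv) (fOf κ Φ t p O fv)) t σu c - ((B.pr : ℕ) : Site 2)) (rootFrame (φL κ Φ t p O.D O.DT O.ori (gOf κ Φ t p O gv) (fOf κ Φ t p O fv)) t σu c + ((B.pr : ℕ) : Site 2)))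
    (hFb : ∀ c, ∀ w ∈ Fb c, w ∈ Qb c ∧ rootFrame (φL κ Φ t p O.D O.DT O.ori (gOf κ Φ t p O gv) (fOf κ Φ t p O fv)) t σu w ∈ Finset.Icc (rootFrame (φL κ Φ t p O.D O.DT O.ori (gOf κ Φ t p O gv) (fOf κ Φ t p O fv)) t σu c + B.dlo) (rootFrame (φL κ Φ t p O.D O.DT O.ori (gOf κ Φ t p O gv) (fOf κ Φ t p O fv)) t σu c + B.dhi))
    (hFZ : ∀ c, Disjoint (Fb c) (O.merged.Λ c (Mu O.merged)))
    (hbridge : ∀ c, 1 - κ.δr (0 + 1 + Nx + 1 + Ny) ^ 2 < (bondPercolation G q).real (linkIn (↑(Qb c) : Set V) (O.merged.Λ c O.merged.k) (Fb c)))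
    -- ROOM NUMBERS (a): the hop's landing box inside core `0` of the bridge; the long prism inside the window
    (hB0 : Finset.Icc (Skelφ.pt (nL κ Φ t p O.merged (gOf κ Φ t p O gv) (fOf κ Φ t p O fv)) (σu * (hL κ Φ t p O.merged (gOf κ Φ t p O gv) (fOf κ Φ t p O fv)))) (Skelφ.pt (nL κ Φ t p O.merged (gOf κ Φ t p O gv) (fOf κ Φ t p O fv)) (σu * (hL κ Φ t p O.merged (gOf κ Φ t p O gv) (fOf κ Φ t p O fv)) + (ℓL κ Φ t p O.merged (gOf κ Φ t p O gv) (fOf κ Φ t p O fv)))) ⊆ Finset.Icc B.B₀lo B.B₀hi) (hRlπ : (O.merged.R (O.merged.scale t (ML κ Φ t p O.merged (gOf κ Φ t p O gv)) (nL κ Φ t p O.merged (gOf κ Φ t p O gv) (fOf κ Φ t p O fv)))) ≤ Rπ)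
    -- ROOM NUMBERS (b): near-root reach of the bridge region and the hop prism, READ BY THE TWO LATTICE FUNCTIONALS `Λ₀ = |vβΔ₀ − vαΔ₁|`, `Λ₁ = |nΔ₁ − hΔ₀|` (B.17 (L-R2′))
    {Λ₀ Λ₁ kR₀ kR₁ : ℤ}
    (hΛR : ∀ x ∈ Finset.Icc B.regionLo B.regionHi, |(Skelφ.NegPrm.vβOf (nL κ Φ t p O.merged (gOf κ Φ t p O gv) (fOf κ Φ t p O fv)) (hL κ Φ t p O.merged (gOf κ Φ t p O gv) (fOf κ Φ t p O fv)) (ℓL κ Φ t p O.merged (gOf κ Φ t p O gv) (fOf κ Φ t p O fv)) (vL κ Φ t p O.merged (gOf κ Φ t p O gv) (fOf κ Φ t p O fv))) * (σu * x 0) - (vL κ Φ t p O.merged (gOf κ Φ t p O gv) (fOf κ Φ t p O fv)) * x 1| ≤ Λ₀ ∧ |(((nL κ Φ t p O.merged (gOf κ Φ t p O gv) (fOf κ Φ t p O fv)) : ℕ) : ℤ) * x 1 - (hL κ Φ t p O.merged (gOf κ Φ t p O gv) (fOf κ Φ t p O fv)) * (σu * x 0)| ≤ Λ₁)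
    (hΛQ0 : TwoAxis.Para.modulus (nL κ Φ t p O.merged (gOf κ Φ t p O gv) (fOf κ Φ t p O fv)) (hL κ Φ t p O.merged (gOf κ Φ t p O gv) (fOf κ Φ t p O fv)) (vL κ Φ t p O.merged (gOf κ Φ t p O gv) (fOf κ Φ t p O fv)) (Skelφ.NegPrm.vβOf (nL κ Φ t p O.merged (gOf κ Φ t p O gv) (fOf κ Φ t p O fv)) (hL κ Φ t p O.merged (gOf κ Φ t p O gv) (fOf κ Φ t p O fv)) (ℓL κ Φ t p O.merged (gOf κ Φ t p O gv) (fOf κ Φ t p O fv)) (vL κ Φ t p O.merged (gOf κ Φ t p O gv) (fOf κ Φ t p O fv))) + (((nL κ Φ t p O.merged (gOf κ Φ t p O gv) (fOf κ Φ t p O fv)) : ℕ) : ℤ) * ((3 * (ℓL κ Φ t p O.merged (gOf κ Φ t p O gv) (fOf κ Φ t p O fv)) : ℕ) : ℤ) ≤ Λ₀) (hΛQ1 : (((nL κ Φ t p O.merged (gOf κ Φ t p O gv) (fOf κ Φ t p O fv)) : ℕ) : ℤ) * ((3 * (ℓL κ Φ t p O.merged (gOf κ Φ t p O gv) (fOf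 κ Φ t p O fv)) : ℕ) : ℤ) ≤ Λ₁)
    (hkR0 : 20 * (((fcells κ Φ t p O.merged (gOf κ Φ t p O gv) (fOf κ Φ t p O fv))).K : ℤ) * (((fcells κ Φ t p O.merged (gOf κ Φ t p O gv) (fOf κ Φ t p O fv))).s 0 : ℤ) * (|(800 : ℤ)| * Λ₀) ≤ kR₀ * (Skelφ.NegPrm.Dof (nL κ Φ t p O.merged (gOf κ Φ t p O gv) (fOf κ Φ t p O fv)) (hL κ Φ t p O.merged (gOf κ Φ t p O gv) (fOf κ Φ t p O fv)) (ℓL κ Φ t p O.merged (gOf κ Φ t p O gv) (fOf κ Φ t p O fv)) (vL κ Φ t p O.merged (gOf κ Φ t p O gv) (fOf κ Φ t p O fv))))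
    (hkR1 : 20 * (((fcells κ Φ t p O.merged (gOf κ Φ t p O gv) (fOf κ Φ t p O fv))).K : ℤ) * (((fcells κ Φ t p O.merged (gOf κ Φ t p O gv) (fOf κ Φ t p O fv))).s 1 : ℤ) * (|(800 : ℤ)| * Λ₁) ≤ kR₁ * (Skelφ.NegPrm.Dof (nL κ Φ t p O.merged (gOf κ Φ t p O gv) (fOf κ Φ t p O fv)) (hL κ Φ t p O.merged (gOf κ Φ t p O gv) (fOf κ Φ t p O fv)) (ℓL κ Φ t p O.merged (gOf κ Φ t p O gv) (fOf κ Φ t p O fv)) (vL κ Φ t p O.merged (gOf κ Φ t p O gv) (fOf κ Φ t p O fv))))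
    (hfR0 : du.1 = 0 → -(5 * (((fcells κ Φ t p O.merged (gOf κ Φ t p O gv) (fOf κ Φ t p O fv))).r du.1 : ℤ)) + 1 ≤ -kR₀ ∧ kR₀ ≤ 25 * (((fcells κ Φ t p O.merged (gOf κ Φ t p O gv) (fOf κ Φ t p O fv))).r du.1 : ℤ) - 1 ∧ kR₁ ≤ 5 * (((fcells κ Φ t p O.merged (gOf κ Φ t p O gv) (fOf κ Φ t p O fv))).r (oth du.1) : ℤ) - 2)
    (hfR1 : du.1 = 1 → -(5 * (((fcells κ Φ t p O.merged (gOf κ Φ t p O gv) (fOf κ Φ t p O fv))).r du.1 : ℤ)) + 1 ≤ -kR₁ ∧ kR₁ ≤ 25 * (((fcells κ Φ t p O.merged (gOf κ Φ t p O gv) (fOf κ Φ t p O fv))).r du.1 : ℤ) - 1 ∧ kR₀ ≤ 5 * (((fcells κ Φ t p O.merged (gOf κ Φ t p O gv) (fOf κ Φ t p O fv))).r (oth du.1) : ℤ) - 2)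
    -- ROOM NUMBERS (c): the x-prefix's prism as an x-frame box and its fine reading (root world), sign `σu`, origin `yX`
    {paLo pbLo paHi pbHi : ℤ}
    (hprism : (xRunSched (nL κ Φ t p O.merged (gOf κ Φ t p O gv) (fOf κ Φ t p O fv)) (ℓL κ Φ t p O.merged (gOf κ Φ t p O gv) (fOf κ Φ t p O fv)) (hL κ Φ t p O.merged (gOf κ Φ t p O gv) (fOf κ Φ t p O fv)) (KS.RA' κ Φ t p O.merged mk) qX Nx).prism ⊆ Finset.Icc (Skelφ.pt paLo pbLo) (Skelφ.pt paHi pbHi))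
    {PLO PHI LLO LHI : Site 2}
    (hP0 : PLO 0 ≤ TwoAxis.Para.coarse (20 * (((fcells κ Φ t p O.merged (gOf κ Φ t p O gv) (fOf κ Φ t p O fv))).K : ℤ) * (((fcells κ Φ t p O.merged (gOf κ Φ t p O gv) (fOf κ Φ t p O fv))).s 0 : ℤ)) ((Skelφ.NegPrm.Dof (nL κ Φ t p O.merged (gOf κ Φ t p O gv) (fOf κ Φ t p O fv)) (hL κ Φ t p O.merged (gOf κ Φ t p O gv) (fOf κ Φ t p O fv)) (ℓL κ Φ t p O.merged (gOf κ Φ t p O gv) (fOf κ Φ t p O fv)) (vL κ Φ t p O.merged (gOf κ Φ t p O gv) (fOf κ Φ t p O fv))) / 2) (Skelφ.NegPrm.Dof (nL κ Φ t p O.merged (gOf κ Φ t p O gv) (fOf κ Φ t p O fv)) (hL κ Φ t p O.merged (gOf κ Φ t p O gv) (fOf κ Φ t p O fv)) (ℓL κ Φ t p O.merged (gOf κ Φ t p O gv) (fOf κ Φ t p O fv)) (vL κ Φ t p O.merged (gOf κ Φ t p O gv) (fOf κ Φ t p O fv))) (TwoAxis.Para.lam0 800 (vL κ Φ t p O.merged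 (gOf κ Φ t p O gv) (fOf κ Φ t p O fv)) (Skelφ.NegPrm.vβOf (nL κ Φ t p O.merged (gOf κ Φ t p O gv) (fOf κ Φ t p O fv)) (hL κ Φ t p O.merged (gOf κ Φ t p O gv) (fOf κ Φ t p O fv)) (ℓL κ Φ t p O.merged (gOf κ Φ t p O gv) (fOf κ Φ t p O fv)) (vL κ Φ t p O.merged (gOf κ Φ t p O gv) (fOf κ Φ t p O fv))) yX) +
      (20 * (((fcells κ Φ t p O.merged (gOf κ Φ t p O gv) (fOf κ Φ t p O fv))).K : ℤ) * (((fcells κ Φ t p O.merged (gOf κ Φ t p O gv) (fOf κ Φ t p O fv))).s 0 : ℤ) * (800 * (TwoAxis.Para.modulus (nL κ Φ t p O.merged (gOf κ Φ t p O gv) (fOf κ Φ t p O fv)) (hL κ Φ t p O.merged (gOf κ Φ t p O gv) (fOf κ Φ t p O fv)) (vL κ Φ t p O.merged (gOf κ Φ t p O gv) (fOf κ Φ t p O fv)) (Skelφ.NegPrm.vβOf (nL κ Φ t p O.merged (gOf κ Φ t p O gv) (fOf κ Φ t p O fv)) (hL κ Φ t p O.merged (gOf κ Φ t p O gv) (fOf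 κ Φ t p O fv)) (ℓL κ Φ t p O.merged (gOf κ Φ t p O gv) (fOf κ Φ t p O fv)) (vL κ Φ t p O.merged (gOf κ Φ t p O gv) (fOf κ Φ t p O fv))) * (min (σu * paLo) (σu * paHi)) -
        max ((vL κ Φ t p O.merged (gOf κ Φ t p O gv) (fOf κ Φ t p O fv)) * ((shearUnit (nL κ Φ t p O.merged (gOf κ Φ t p O gv) (fOf κ Φ t p O fv)) (hL κ Φ t p O.merged (gOf κ Φ t p O gv) (fOf κ Φ t p O fv)) : ℤ) * (min (σu * pbLo) (σu * pbHi) - 1))) ((vL κ Φ t p O.merged (gOf κ Φ t p O gv) (fOf κ Φ t p O fv)) * ((shearUnit (nL κ Φ t p O.merged (gOf κ Φ t p O gv) (fOf κ Φ t p O fv)) (hL κ Φ t p O.merged (gOf κ Φ t p O gv) (fOf κ Φ t p O fv)) : ℤ) * (max (σu * pbLo) (σu * pbHi)) + shearUnit (nL κ Φ t p O.merged (gOf κ Φ t p O gv) (fOf κ Φ t p O fv)) (hL κ Φ t p O.merged (gOf κ Φ t p O gv) (fOf κ Φ t p O fv)) - 1))) / (nL κ Φ t p O.merged (gOf κ Φ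 t p O gv) (fOf κ Φ t p O fv)))) / (Skelφ.NegPrm.Dof (nL κ Φ t p O.merged (gOf κ Φ t p O gv) (fOf κ Φ t p O fv)) (hL κ Φ t p O.merged (gOf κ Φ t p O gv) (fOf κ Φ t p O fv)) (ℓL κ Φ t p O.merged (gOf κ Φ t p O gv) (fOf κ Φ t p O fv)) (vL κ Φ t p O.merged (gOf κ Φ t p O gv) (fOf κ Φ t p O fv))))
    (hP1 : TwoAxis.Para.coarse (20 * (((fcells κ Φ t p O.merged (gOf κ Φ t p O gv) (fOf κ Φ t p O fv))).K : ℤ) * (((fcells κ Φ t p O.merged (gOf κ Φ t p O gv) (fOf κ Φ t p O fv))).s 0 : ℤ)) ((Skelφ.NegPrm.Dof (nL κ Φ t p O.merged (gOf κ Φ t p O gv) (fOf κ Φ t p O fv)) (hL κ Φ t p O.merged (gOf κ Φ t p O gv) (fOf κ Φ t p O fv)) (ℓL κ Φ t p O.merged (gOf κ Φ t p O gv) (fOf κ Φ t p O fv)) (vL κ Φ t p O.merged (gOf κ Φ t p O gv) (fOf κ Φ t p O fv))) / 2) (Skelφ.NegPrm.Dof (nL κ Φ t p O.merged (gOf κ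 Φ t p O gv) (fOf κ Φ t p O fv)) (hL κ Φ t p O.merged (gOf κ Φ t p O gv) (fOf κ Φ t p O fv)) (ℓL κ Φ t p O.merged (gOf κ Φ t p O gv) (fOf κ Φ t p O fv)) (vL κ Φ t p O.merged (gOf κ Φ t p O gv) (fOf κ Φ t p O fv))) (TwoAxis.Para.lam0 800 (vL κ Φ t p O.merged (gOf κ Φ t p O gv) (fOf κ Φ t p O fv)) (Skelφ.NegPrm.vβOf (nL κ Φ t p O.merged (gOf κ Φ t p O gv) (fOf κ Φ t p O fv)) (hL κ Φ t p O.merged (gOf κ Φ t p O gv) (fOf κ Φ t p O fv)) (ℓL κ Φ t p O.merged (gOf κ Φ t p O gv) (fOf κ Φ t p O fv)) (vL κ Φ t p O.merged (gOf κ Φ t p O gv) (fOf κ Φ t p O fv))) yX) +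
      (20 * (((fcells κ Φ t p O.merged (gOf κ Φ t p O gv) (fOf κ Φ t p O fv))).K : ℤ) * (((fcells κ Φ t p O.merged (gOf κ Φ t p O gv) (fOf κ Φ t p O fv))).s 0 : ℤ) * (800 * (TwoAxis.Para.modulus (nL κ Φ t p O.merged (gOf κ Φ t p O gv) (fOf κ Φ t p O fv)) (hL κ Φ t p O.merged (gOf κ Φ t p O gv) (fOf κ Φ t p O fv)) (vL κ Φ t p O.merged (gOf κ Φ t p O gv) (fOf κ Φ t p O fv)) (Skelφ.NegPrm.vβOf (nL κ Φ t p O.merged (gOf κ Φ t p O gv) (fOf κ Φ t p O fv)) (hL κ Φ t p O.merged (gOf κ Φ t p O gv) (fOf κ Φ t p O fv)) (ℓL κ Φ t p O.merged (gOf κ Φ t p O gv) (fOf κ Φ t p O fv)) (vL κ Φ t p O.merged (gOf κ Φ t p O gv) (fOf κ Φ t p O fv))) * (max (σu * paLo) (σu * paHi)) -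
        min ((vL κ Φ t p O.merged (gOf κ Φ t p O gv) (fOf κ Φ t p O fv)) * ((shearUnit (nL κ Φ t p O.merged (gOf κ Φ t p O gv) (fOf κ Φ t p O fv)) (hL κ Φ t p O.merged (gOf κ Φ t p O gv) (fOf κ Φ t p O fv)) : ℤ) * (min (σu * pbLo) (σu * pbHi) - 1))) ((vL κ Φ t p O.merged (gOf κ Φ t p O gv) (fOf κ Φ t p O fv)) * ((shearUnit (nL κ Φ t p O.merged (gOf κ Φ t p O gv) (fOf κ Φ t p O fv)) (hL κ Φ t p O.merged (gOf κ Φ t p O gv) (fOf κ Φ t p O fv)) : ℤ) * (max (σu * pbLo) (σu * pbHi)) + shearUnit (nL κ Φ t p O.merged (gOf κ Φ t p O gv) (fOf κ Φ t p O fv)) (hL κ Φ t p O.merged (gOf κ Φ t p O gv) (fOf κ Φ t p O fv)) - 1))) / (nL κ Φ t p O.merged (gOf κ Φ t p O gv) (fOf κ Φ t p O fv)))) / (Skelφ.NegPrm.Dof (nL κ Φ t p O.merged (gOf κ Φ t p O gv) (fOf κ Φ t p O fv)) (hL κ Φ t p O.merged (gOf κ Φ t p O gv) (fOf κ Φ t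 p O fv)) (ℓL κ Φ t p O.merged (gOf κ Φ t p O gv) (fOf κ Φ t p O fv)) (vL κ Φ t p O.merged (gOf κ Φ t p O gv) (fOf κ Φ t p O fv)))
        + 1 ≤ PHI 0)
    (hP2 : PLO 1 ≤ TwoAxis.Para.coarse (20 * (((fcells κ Φ t p O.merged (gOf κ Φ t p O gv) (fOf κ Φ t p O fv))).K : ℤ) * (((fcells κ Φ t p O.merged (gOf κ Φ t p O gv) (fOf κ Φ t p O fv))).s 1 : ℤ)) ((Skelφ.NegPrm.Dof (nL κ Φ t p O.merged (gOf κ Φ t p O gv) (fOf κ Φ t p O fv)) (hL κ Φ t p O.merged (gOf κ Φ t p O gv) (fOf κ Φ t p O fv)) (ℓL κ Φ t p O.merged (gOf κ Φ t p O gv) (fOf κ Φ t p O fv)) (vL κ Φ t p O.merged (gOf κ Φ t p O gv) (fOf κ Φ t p O fv))) / 2) (Skelφ.NegPrm.Dof (nL κ Φ t p O.merged (gOf κ Φ t p O gv) (fOf κ Φ t p O fv)) (hL κ Φ t p O.merged (gOf κ Φ t p O gv) (fOf κ Φ t p O fv)) (ℓL κ Φ t p O.merged (gOf κ Φ t p O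 gv) (fOf κ Φ t p O fv)) (vL κ Φ t p O.merged (gOf κ Φ t p O gv) (fOf κ Φ t p O fv))) (TwoAxis.Para.lam1 800 (nL κ Φ t p O.merged (gOf κ Φ t p O gv) (fOf κ Φ t p O fv)) (hL κ Φ t p O.merged (gOf κ Φ t p O gv) (fOf κ Φ t p O fv)) yX) +
      (20 * (((fcells κ Φ t p O.merged (gOf κ Φ t p O gv) (fOf κ Φ t p O fv))).K : ℤ) * (((fcells κ Φ t p O.merged (gOf κ Φ t p O gv) (fOf κ Φ t p O fv))).s 1 : ℤ) * (800 * ((shearUnit (nL κ Φ t p O.merged (gOf κ Φ t p O gv) (fOf κ Φ t p O fv)) (hL κ Φ t p O.merged (gOf κ Φ t p O gv) (fOf κ Φ t p O fv)) : ℤ) * (min (σu * pbLo) (σu * pbHi) - 1)))) / (Skelφ.NegPrm.Dof (nL κ Φ t p O.merged (gOf κ Φ t p O gv) (fOf κ Φ t p O fv)) (hL κ Φ t p O.merged (gOf κ Φ t p O gv) (fOf κ Φ t p O fv)) (ℓL κ Φ t p O.merged (gOf κ Φ t p O gv) (fOf κ Φ t p O fv)) (vL κ Φ t p O.merged (gOf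 κ Φ t p O gv) (fOf κ Φ t p O fv))))
    (hP3 : TwoAxis.Para.coarse (20 * (((fcells κ Φ t p O.merged (gOf κ Φ t p O gv) (fOf κ Φ t p O fv))).K : ℤ) * (((fcells κ Φ t p O.merged (gOf κ Φ t p O gv) (fOf κ Φ t p O fv))).s 1 : ℤ)) ((Skelφ.NegPrm.Dof (nL κ Φ t p O.merged (gOf κ Φ t p O gv) (fOf κ Φ t p O fv)) (hL κ Φ t p O.merged (gOf κ Φ t p O gv) (fOf κ Φ t p O fv)) (ℓL κ Φ t p O.merged (gOf κ Φ t p O gv) (fOf κ Φ t p O fv)) (vL κ Φ t p O.merged (gOf κ Φ t p O gv) (fOf κ Φ t p O fv))) / 2) (Skelφ.NegPrm.Dof (nL κ Φ t p O.merged (gOf κ Φ t p O gv) (fOf κ Φ t p O fv)) (hL κ Φ t p O.merged (gOf κ Φ t p O gv) (fOf κ Φ t p O fv)) (ℓL κ Φ t p O.merged (gOf κ Φ t p O gv) (fOf κ Φ t p O fv)) (vL κ Φ t p O.merged (gOf κ Φ t p O gv) (fOf κ Φ t p O fv))) (TwoAxis.Para.lam1 800 (nL κ Φ t p O.merged (gOf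 κ Φ t p O gv) (fOf κ Φ t p O fv)) (hL κ Φ t p O.merged (gOf κ Φ t p O gv) (fOf κ Φ t p O fv)) yX) +
      (20 * (((fcells κ Φ t p O.merged (gOf κ Φ t p O gv) (fOf κ Φ t p O fv))).K : ℤ) * (((fcells κ Φ t p O.merged (gOf κ Φ t p O gv) (fOf κ Φ t p O fv))).s 1 : ℤ) * (800 * ((shearUnit (nL κ Φ t p O.merged (gOf κ Φ t p O gv) (fOf κ Φ t p O fv)) (hL κ Φ t p O.merged (gOf κ Φ t p O gv) (fOf κ Φ t p O fv)) : ℤ) * (max (σu * pbLo) (σu * pbHi)) + shearUnit (nL κ Φ t p O.merged (gOf κ Φ t p O gv) (fOf κ Φ t p O fv)) (hL κ Φ t p O.merged (gOf κ Φ t p O gv) (fOf κ Φ t p O fv)) - 1))) / (Skelφ.NegPrm.Dof (nL κ Φ t p O.merged (gOf κ Φ t p O gv) (fOf κ Φ t p O fv)) (hL κ Φ t p O.merged (gOf κ Φ t p O gv) (fOf κ Φ t p O fv)) (ℓL κ Φ t p O.merged (gOf κ Φ t p O gv) (fOf κ Φ t p O fv)) (vL κ Φ t p O.merged (gOf κ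 Φ t p O gv) (fOf κ Φ t p O fv))) + 1 ≤ PHI 1)
    (hPf₁ : sgOf du = 1 → -(5 * (((fcells κ Φ t p O.merged (gOf κ Φ t p O gv) (fOf κ Φ t p O fv))).r du.1 : ℤ)) + 1 ≤ PLO du.1 ∧ PHI du.1 ≤ 25 * (((fcells κ Φ t p O.merged (gOf κ Φ t p O gv) (fOf κ Φ t p O fv))).r du.1 : ℤ) - 1)
    (hPf₂ : sgOf du = -1 → -(5 * (((fcells κ Φ t p O.merged (gOf κ Φ t p O gv) (fOf κ Φ t p O fv))).r du.1 : ℤ)) + 1 ≤ -PHI du.1 ∧ -PLO du.1 ≤ 25 * (((fcells κ Φ t p O.merged (gOf κ Φ t p O gv) (fOf κ Φ t p O fv))).r du.1 : ℤ) - 1)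
    (hPf₃ : -(5 * (((fcells κ Φ t p O.merged (gOf κ Φ t p O gv) (fOf κ Φ t p O fv))).r (oth du.1) : ℤ) - 2) ≤ PLO (oth du.1) ∧ PHI (oth du.1) ≤ 5 * (((fcells κ Φ t p O.merged (gOf κ Φ t p O gv) (fOf κ Φ t p O fv))).r (oth du.1) : ℤ) - 2)
    -- ROOM NUMBERS (c′): the y′-run's REGIONS ONE BY ONE (hp-8 g33: no prism-hull reading of a drifting run) and its last core as y′-frame boxes; fine readings (sign `sgOf du`, origin `yY`)
    {qaLo qbLo qaHi qbHi : ℕ → ℤ} (hregY : ∀ k ≤ Ny, (yRunSched (one_le_nL_of_atQOS (atQOS_of_atQOT hAt)) (abs_vL_le_of_atQOS (atQOS_of_atQOT hAt)) (layer_of_atQOS (atQOS_of_atQOT hAt)) (KS.RA' κ Φ t p O.merged mk) qY Ny).region k ⊆ Finset.Icc (Skelφ.pt (qbLo k) (qaLo k)) (Skelφ.pt (qbHi k) (qaHi k)))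
    {maLo mbLo maHi mbHi : ℤ} (hlastcY : (yRunSched (one_le_nL_of_atQOS (atQOS_of_atQOT hAt)) (abs_vL_le_of_atQOS (atQOS_of_atQOT hAt)) (layer_of_atQOS (atQOS_of_atQOT hAt)) (KS.RA' κ Φ t p O.merged mk) qY Ny).core (Ny + 1) ⊆ Finset.Icc (Skelφ.pt mbLo maLo) (Skelφ.pt mbHi maHi))
    {QLO QHI : ℕ → Site 2}
    (hQ0 : ∀ k ≤ Ny, QLO k 0 ≤ TwoAxis.Para.coarse (20 * (((fcells κ Φ t p O.merged (gOf κ Φ t p O gv) (fOf κ Φ t p O fv))).K : ℤ) * (((fcells κ Φ t p O.merged (gOf κ Φ t p O gv) (fOf κ Φ t p O fv))).s 0 : ℤ)) ((Skelφ.NegPrm.Dof (nL κ Φ t p O.merged (gOf κ Φ t p O gv) (fOf κ Φ t p O fv)) (hL κ Φ t p O.merged (gOf κ Φ t p O gv) (fOf κ Φ t p O fv)) (ℓL κ Φ t p O.merged (gOf κ Φ t p O gv) (fOf κ Φ t p O fv)) (vL κ Φ t p O.merged (gOf κ Φ t p O gv) (fOf κ Φ t p O fv))) / 2) (Skelφ.NegPrm.Dof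 (nL κ Φ t p O.merged (gOf κ Φ t p O gv) (fOf κ Φ t p O fv)) (hL κ Φ t p O.merged (gOf κ Φ t p O gv) (fOf κ Φ t p O fv)) (ℓL κ Φ t p O.merged (gOf κ Φ t p O gv) (fOf κ Φ t p O fv)) (vL κ Φ t p O.merged (gOf κ Φ t p O gv) (fOf κ Φ t p O fv))) (TwoAxis.Para.lam0 800 (vL κ Φ t p O.merged (gOf κ Φ t p O gv) (fOf κ Φ t p O fv)) (Skelφ.NegPrm.vβOf (nL κ Φ t p O.merged (gOf κ Φ t p O gv) (fOf κ Φ t p O fv)) (hL κ Φ t p O.merged (gOf κ Φ t p O gv) (fOf κ Φ t p O fv)) (ℓL κ Φ t p O.merged (gOf κ Φ t p O gv) (fOf κ Φ t p O fv)) (vL κ Φ t p O.merged (gOf κ Φ t p O gv) (fOf κ Φ t p O fv))) yY) +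
      (20 * (((fcells κ Φ t p O.merged (gOf κ Φ t p O gv) (fOf κ Φ t p O fv))).K : ℤ) * (((fcells κ Φ t p O.merged (gOf κ Φ t p O gv) (fOf κ Φ t p O fv))).s 0 : ℤ) * (800 * (TwoAxis.Para.modulus (nL κ Φ t p O.merged (gOf κ Φ t p O gv) (fOf κ Φ t p O fv)) (hL κ Φ t p O.merged (gOf κ Φ t p O gv) (fOf κ Φ t p O fv)) (vL κ Φ t p O.merged (gOf κ Φ t p O gv) (fOf κ Φ t p O fv)) (Skelφ.NegPrm.vβOf (nL κ Φ t p O.merged (gOf κ Φ t p O gv) (fOf κ Φ t p O fv)) (hL κ Φ t p O.merged (gOf κ Φ t p O gv) (fOf κ Φ t p O fv)) (ℓL κ Φ t p O.merged (gOf κ Φ t p O gv) (fOf κ Φ t p O fv)) (vL κ Φ t p O.merged (gOf κ Φ t p O gv) (fOf κ Φ t p O fv))) * (min (sgOf du * qaLo k) (sgOf du * qaHi k)) -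
        max ((vL κ Φ t p O.merged (gOf κ Φ t p O gv) (fOf κ Φ t p O fv)) * ((shearUnit (nL κ Φ t p O.merged (gOf κ Φ t p O gv) (fOf κ Φ t p O fv)) (hL κ Φ t p O.merged (gOf κ Φ t p O gv) (fOf κ Φ t p O fv)) : ℤ) * (min (sgOf du * qbLo k) (sgOf du * qbHi k) - 1))) ((vL κ Φ t p O.merged (gOf κ Φ t p O gv) (fOf κ Φ t p O fv)) * ((shearUnit (nL κ Φ t p O.merged (gOf κ Φ t p O gv) (fOf κ Φ t p O fv)) (hL κ Φ t p O.merged (gOf κ Φ t p O gv) (fOf κ Φ t p O fv)) : ℤ) * (max (sgOf du * qbLo k) (sgOf du * qbHi k)) + shearUnit (nL κ Φ t p O.merged (gOf κ Φ t p O gv) (fOf κ Φ t p O fv)) (hL κ Φ t p O.merged (gOf κ Φ t p O gv) (fOf κ Φ t p O fv)) - 1))) / (nL κ Φ t p O.merged (gOf κ Φ t p O gv) (fOf κ Φ t p O fv)))) / (Skelφ.NegPrm.Dof (nL κ Φ t p O.merged (gOf κ Φ t p O gv) (fOf κ Φ t p O fv)) (hL κ Φ t p O.merged (gOf κ Φ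 t p O gv) (fOf κ Φ t p O fv)) (ℓL κ Φ t p O.merged (gOf κ Φ t p O gv) (fOf κ Φ t p O fv)) (vL κ Φ t p O.merged (gOf κ Φ t p O gv) (fOf κ Φ t p O fv))))
    (hQ1 : ∀ k ≤ Ny, TwoAxis.Para.coarse (20 * (((fcells κ Φ t p O.merged (gOf κ Φ t p O gv) (fOf κ Φ t p O fv))).K : ℤ) * (((fcells κ Φ t p O.merged (gOf κ Φ t p O gv) (fOf κ Φ t p O fv))).s 0 : ℤ)) ((Skelφ.NegPrm.Dof (nL κ Φ t p O.merged (gOf κ Φ t p O gv) (fOf κ Φ t p O fv)) (hL κ Φ t p O.merged (gOf κ Φ t p O gv) (fOf κ Φ t p O fv)) (ℓL κ Φ t p O.merged (gOf κ Φ t p O gv) (fOf κ Φ t p O fv)) (vL κ Φ t p O.merged (gOf κ Φ t p O gv) (fOf κ Φ t p O fv))) / 2) (Skelφ.NegPrm.Dof (nL κ Φ t p O.merged (gOf κ Φ t p O gv) (fOf κ Φ t p O fv)) (hL κ Φ t p O.merged (gOf κ Φ t p O gv) (fOf κ Φ t p O fv)) (ℓL κ Φ t p O.merged (gOf κ Φ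 t p O gv) (fOf κ Φ t p O fv)) (vL κ Φ t p O.merged (gOf κ Φ t p O gv) (fOf κ Φ t p O fv))) (TwoAxis.Para.lam0 800 (vL κ Φ t p O.merged (gOf κ Φ t p O gv) (fOf κ Φ t p O fv)) (Skelφ.NegPrm.vβOf (nL κ Φ t p O.merged (gOf κ Φ t p O gv) (fOf κ Φ t p O fv)) (hL κ Φ t p O.merged (gOf κ Φ t p O gv) (fOf κ Φ t p O fv)) (ℓL κ Φ t p O.merged (gOf κ Φ t p O gv) (fOf κ Φ t p O fv)) (vL κ Φ t p O.merged (gOf κ Φ t p O gv) (fOf κ Φ t p O fv))) yY) +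
      (20 * (((fcells κ Φ t p O.merged (gOf κ Φ t p O gv) (fOf κ Φ t p O fv))).K : ℤ) * (((fcells κ Φ t p O.merged (gOf κ Φ t p O gv) (fOf κ Φ t p O fv))).s 0 : ℤ) * (800 * (TwoAxis.Para.modulus (nL κ Φ t p O.merged (gOf κ Φ t p O gv) (fOf κ Φ t p O fv)) (hL κ Φ t p O.merged (gOf κ Φ t p O gv) (fOf κ Φ t p O fv)) (vL κ Φ t p O.merged (gOf κ Φ t p O gv) (fOf κ Φ t p O fv)) (Skelφ.NegPrm.vβOf (nL κ Φ t p O.merged (gOf κ Φ t p O gv) (fOf κ Φ t p O fv)) (hL κ Φ t p O.merged (gOf κ Φ t p O gv) (fOf κ Φ t p O fv)) (ℓL κ Φ t p O.merged (gOf κ Φ t p O gv) (fOf κ Φ t p O fv)) (vL κ Φ t p O.merged (gOf κ Φ t p O gv) (fOf κ Φ t p O fv))) * (max (sgOf du * qaLo k) (sgOf du * qaHi k)) -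
        min ((vL κ Φ t p O.merged (gOf κ Φ t p O gv) (fOf κ Φ t p O fv)) * ((shearUnit (nL κ Φ t p O.merged (gOf κ Φ t p O gv) (fOf κ Φ t p O fv)) (hL κ Φ t p O.merged (gOf κ Φ t p O gv) (fOf κ Φ t p O fv)) : ℤ) * (min (sgOf du * qbLo k) (sgOf du * qbHi k) - 1))) ((vL κ Φ t p O.merged (gOf κ Φ t p O gv) (fOf κ Φ t p O fv)) * ((shearUnit (nL κ Φ t p O.merged (gOf κ Φ t p O gv) (fOf κ Φ t p O fv)) (hL κ Φ t p O.merged (gOf κ Φ t p O gv) (fOf κ Φ t p O fv)) : ℤ) * (max (sgOf du * qbLo k) (sgOf du * qbHi k)) + shearUnit (nL κ Φ t p O.merged (gOf κ Φ t p O gv) (fOf κ Φ t p O fv)) (hL κ Φ t p O.merged (gOf κ Φ t p O gv) (fOf κ Φ t p O fv)) - 1))) / (nL κ Φ t p O.merged (gOf κ Φ t p O gv) (fOf κ Φ t p O fv)))) / (Skelφ.NegPrm.Dof (nL κ Φ t p O.merged (gOf κ Φ t p O gv) (fOf κ Φ t p O fv)) (hL κ Φ t p O.merged (gOf κ Φ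 t p O gv) (fOf κ Φ t p O fv)) (ℓL κ Φ t p O.merged (gOf κ Φ t p O gv) (fOf κ Φ t p O fv)) (vL κ Φ t p O.merged (gOf κ Φ t p O gv) (fOf κ Φ t p O fv)))
        + 1 ≤ QHI k 0)
    (hQ2 : ∀ k ≤ Ny, QLO k 1 ≤ TwoAxis.Para.coarse (20 * (((fcells κ Φ t p O.merged (gOf κ Φ t p O gv) (fOf κ Φ t p O fv))).K : ℤ) * (((fcells κ Φ t p O.merged (gOf κ Φ t p O gv) (fOf κ Φ t p O fv))).s 1 : ℤ)) ((Skelφ.NegPrm.Dof (nL κ Φ t p O.merged (gOf κ Φ t p O gv) (fOf κ Φ t p O fv)) (hL κ Φ t p O.merged (gOf κ Φ t p O gv) (fOf κ Φ t p O fv)) (ℓL κ Φ t p O.merged (gOf κ Φ t p O gv) (fOf κ Φ t p O fv)) (vL κ Φ t p O.merged (gOf κ Φ t p O gv) (fOf κ Φ t p O fv))) / 2) (Skelφ.NegPrm.Dof (nL κ Φ t p O.merged (gOf κ Φ t p O gv) (fOf κ Φ t p O fv)) (hL κ Φ t p O.merged (gOf κ Φ t p O gv) (fOf κ Φ t p O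 fv)) (ℓL κ Φ t p O.merged (gOf κ Φ t p O gv) (fOf κ Φ t p O fv)) (vL κ Φ t p O.merged (gOf κ Φ t p O gv) (fOf κ Φ t p O fv))) (TwoAxis.Para.lam1 800 (nL κ Φ t p O.merged (gOf κ Φ t p O gv) (fOf κ Φ t p O fv)) (hL κ Φ t p O.merged (gOf κ Φ t p O gv) (fOf κ Φ t p O fv)) yY) + (20 * (((fcells κ Φ t p O.merged (gOf κ Φ t p O gv) (fOf κ Φ t p O fv))).K : ℤ) * (((fcells κ Φ t p O.merged (gOf κ Φ t p O gv) (fOf κ Φ t p O fv))).s 1 : ℤ) * (800 * ((shearUnit (nL κ Φ t p O.merged (gOf κ Φ t p O gv) (fOf κ Φ t p O fv)) (hL κ Φ t p O.merged (gOf κ Φ t p O gv) (fOf κ Φ t p O fv)) : ℤ) * (min (sgOf du * qbLo k) (sgOf du * qbHi k) - 1)))) / (Skelφ.NegPrm.Dof (nL κ Φ t p O.merged (gOf κ Φ t p O gv) (fOf κ Φ t p O fv)) (hL κ Φ t p O.merged (gOf κ Φ t p O gv) (fOf κ Φ t p O fv)) (ℓL κ Φ t p O.merged (gOf κ Φ t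 p O gv) (fOf κ Φ t p O fv)) (vL κ Φ t p O.merged (gOf κ Φ t p O gv) (fOf κ Φ t p O fv))))
    (hQ3 : ∀ k ≤ Ny, TwoAxis.Para.coarse (20 * (((fcells κ Φ t p O.merged (gOf κ Φ t p O gv) (fOf κ Φ t p O fv))).K : ℤ) * (((fcells κ Φ t p O.merged (gOf κ Φ t p O gv) (fOf κ Φ t p O fv))).s 1 : ℤ)) ((Skelφ.NegPrm.Dof (nL κ Φ t p O.merged (gOf κ Φ t p O gv) (fOf κ Φ t p O fv)) (hL κ Φ t p O.merged (gOf κ Φ t p O gv) (fOf κ Φ t p O fv)) (ℓL κ Φ t p O.merged (gOf κ Φ t p O gv) (fOf κ Φ t p O fv)) (vL κ Φ t p O.merged (gOf κ Φ t p O gv) (fOf κ Φ t p O fv))) / 2) (Skelφ.NegPrm.Dof (nL κ Φ t p O.merged (gOf κ Φ t p O gv) (fOf κ Φ t p O fv)) (hL κ Φ t p O.merged (gOf κ Φ t p O gv) (fOf κ Φ t p O fv)) (ℓL κ Φ t p O.merged (gOf κ Φ t p O gv) (fOf κ Φ t p O fv)) (vL κ Φ t p O.merged (gOf κ Φ t p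 O gv) (fOf κ Φ t p O fv))) (TwoAxis.Para.lam1 800 (nL κ Φ t p O.merged (gOf κ Φ t p O gv) (fOf κ Φ t p O fv)) (hL κ Φ t p O.merged (gOf κ Φ t p O gv) (fOf κ Φ t p O fv)) yY) +
      (20 * (((fcells κ Φ t p O.merged (gOf κ Φ t p O gv) (fOf κ Φ t p O fv))).K : ℤ) * (((fcells κ Φ t p O.merged (gOf κ Φ t p O gv) (fOf κ Φ t p O fv))).s 1 : ℤ) * (800 * ((shearUnit (nL κ Φ t p O.merged (gOf κ Φ t p O gv) (fOf κ Φ t p O fv)) (hL κ Φ t p O.merged (gOf κ Φ t p O gv) (fOf κ Φ t p O fv)) : ℤ) * (max (sgOf du * qbLo k) (sgOf du * qbHi k)) + shearUnit (nL κ Φ t p O.merged (gOf κ Φ t p O gv) (fOf κ Φ t p O fv)) (hL κ Φ t p O.merged (gOf κ Φ t p O gv) (fOf κ Φ t p O fv)) - 1))) / (Skelφ.NegPrm.Dof (nL κ Φ t p O.merged (gOf κ Φ t p O gv) (fOf κ Φ t p O fv)) (hL κ Φ t p O.merged (gOf κ Φ t p O gv) (fOf κ Φ t p O fv)) (ℓL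 κ Φ t p O.merged (gOf κ Φ t p O gv) (fOf κ Φ t p O fv)) (vL κ Φ t p O.merged (gOf κ Φ t p O gv) (fOf κ Φ t p O fv))) + 1 ≤ QHI k 1)
    (hQf₁ : ∀ k ≤ Ny, sgOf du = 1 → -(5 * (((fcells κ Φ t p O.merged (gOf κ Φ t p O gv) (fOf κ Φ t p O fv))).r du.1 : ℤ)) + 1 ≤ QLO k du.1 ∧ QHI k du.1 ≤ 25 * (((fcells κ Φ t p O.merged (gOf κ Φ t p O gv) (fOf κ Φ t p O fv))).r du.1 : ℤ) - 1)
    (hQf₂ : ∀ k ≤ Ny, sgOf du = -1 → -(5 * (((fcells κ Φ t p O.merged (gOf κ Φ t p O gv) (fOf κ Φ t p O fv))).r du.1 : ℤ)) + 1 ≤ -QHI k du.1 ∧ -QLO k du.1 ≤ 25 * (((fcells κ Φ t p O.merged (gOf κ Φ t p O gv) (fOf κ Φ t p O fv))).r du.1 : ℤ) - 1)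
    (hQf₃ : ∀ k ≤ Ny, -(5 * (((fcells κ Φ t p O.merged (gOf κ Φ t p O gv) (fOf κ Φ t p O fv))).r (oth du.1) : ℤ) - 2) ≤ QLO k (oth du.1) ∧ QHI k (oth du.1) ≤ 5 * (((fcells κ Φ t p O.merged (gOf κ Φ t p O gv) (fOf κ Φ t p O fv))).r (oth du.1) : ℤ) - 2)
    (hL0 : LLO 0 ≤ TwoAxis.Para.coarse (20 * (((fcells κ Φ t p O.merged (gOf κ Φ t p O gv) (fOf κ Φ t p O fv))).K : ℤ) * (((fcells κ Φ t p O.merged (gOf κ Φ t p O gv) (fOf κ Φ t p O fv))).s 0 : ℤ)) ((Skelφ.NegPrm.Dof (nL κ Φ t p O.merged (gOf κ Φ t p O gv) (fOf κ Φ t p O fv)) (hL κ Φ t p O.merged (gOf κ Φ t p O gv) (fOf κ Φ t p O fv)) (ℓL κ Φ t p O.merged (gOf κ Φ t p O gv) (fOf κ Φ t p O fv)) (vL κ Φ t p O.merged (gOf κ Φ t p O gv) (fOf κ Φ t p O fv))) / 2) (Skelφ.NegPrm.Dof (nL κ Φ t p O.merged (gOf κ Φ t p O gv) (fOf κ Φ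 t p O fv)) (hL κ Φ t p O.merged (gOf κ Φ t p O gv) (fOf κ Φ t p O fv)) (ℓL κ Φ t p O.merged (gOf κ Φ t p O gv) (fOf κ Φ t p O fv)) (vL κ Φ t p O.merged (gOf κ Φ t p O gv) (fOf κ Φ t p O fv))) (TwoAxis.Para.lam0 800 (vL κ Φ t p O.merged (gOf κ Φ t p O gv) (fOf κ Φ t p O fv)) (Skelφ.NegPrm.vβOf (nL κ Φ t p O.merged (gOf κ Φ t p O gv) (fOf κ Φ t p O fv)) (hL κ Φ t p O.merged (gOf κ Φ t p O gv) (fOf κ Φ t p O fv)) (ℓL κ Φ t p O.merged (gOf κ Φ t p O gv) (fOf κ Φ t p O fv)) (vL κ Φ t p O.merged (gOf κ Φ t p O gv) (fOf κ Φ t p O fv))) yY) +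
      (20 * (((fcells κ Φ t p O.merged (gOf κ Φ t p O gv) (fOf κ Φ t p O fv))).K : ℤ) * (((fcells κ Φ t p O.merged (gOf κ Φ t p O gv) (fOf κ Φ t p O fv))).s 0 : ℤ) * (800 * (TwoAxis.Para.modulus (nL κ Φ t p O.merged (gOf κ Φ t p O gv) (fOf κ Φ t p O fv)) (hL κ Φ t p O.merged (gOf κ Φ t p O gv) (fOf κ Φ t p O fv)) (vL κ Φ t p O.merged (gOf κ Φ t p O gv) (fOf κ Φ t p O fv)) (Skelφ.NegPrm.vβOf (nL κ Φ t p O.merged (gOf κ Φ t p O gv) (fOf κ Φ t p O fv)) (hL κ Φ t p O.merged (gOf κ Φ t p O gv) (fOf κ Φ t p O fv)) (ℓL κ Φ t p O.merged (gOf κ Φ t p O gv) (fOf κ Φ t p O fv)) (vL κ Φ t p O.merged (gOf κ Φ t p O gv) (fOf κ Φ t p O fv))) * (min (sgOf du * maLo) (sgOf du * maHi)) -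
        max ((vL κ Φ t p O.merged (gOf κ Φ t p O gv) (fOf κ Φ t p O fv)) * ((shearUnit (nL κ Φ t p O.merged (gOf κ Φ t p O gv) (fOf κ Φ t p O fv)) (hL κ Φ t p O.merged (gOf κ Φ t p O gv) (fOf κ Φ t p O fv)) : ℤ) * (min (sgOf du * mbLo) (sgOf du * mbHi) - 1))) ((vL κ Φ t p O.merged (gOf κ Φ t p O gv) (fOf κ Φ t p O fv)) * ((shearUnit (nL κ Φ t p O.merged (gOf κ Φ t p O gv) (fOf κ Φ t p O fv)) (hL κ Φ t p O.merged (gOf κ Φ t p O gv) (fOf κ Φ t p O fv)) : ℤ) * (max (sgOf du * mbLo) (sgOf du * mbHi)) + shearUnit (nL κ Φ t p O.merged (gOf κ Φ t p O gv) (fOf κ Φ t p O fv)) (hL κ Φ t p O.merged (gOf κ Φ t p O gv) (fOf κ Φ t p O fv)) - 1))) / (nL κ Φ t p O.merged (gOf κ Φ t p O gv) (fOf κ Φ t p O fv)))) / (Skelφ.NegPrm.Dof (nL κ Φ t p O.merged (gOf κ Φ t p O gv) (fOf κ Φ t p O fv)) (hL κ Φ t p O.merged (gOf κ Φ t p O gv)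 (fOf κ Φ t p O fv)) (ℓL κ Φ t p O.merged (gOf κ Φ t p O gv) (fOf κ Φ t p O fv)) (vL κ Φ t p O.merged (gOf κ Φ t p O gv) (fOf κ Φ t p O fv))))
    (hL1 : TwoAxis.Para.coarse (20 * (((fcells κ Φ t p O.merged (gOf κ Φ t p O gv) (fOf κ Φ t p O fv))).K : ℤ) * (((fcells κ Φ t p O.merged (gOf κ Φ t p O gv) (fOf κ Φ t p O fv))).s 0 : ℤ)) ((Skelφ.NegPrm.Dof (nL κ Φ t p O.merged (gOf κ Φ t p O gv) (fOf κ Φ t p O fv)) (hL κ Φ t p O.merged (gOf κ Φ t p O gv) (fOf κ Φ t p O fv)) (ℓL κ Φ t p O.merged (gOf κ Φ t p O gv) (fOf κ Φ t p O fv)) (vL κ Φ t p O.merged (gOf κ Φ t p O gv) (fOf κ Φ t p O fv))) / 2) (Skelφ.NegPrm.Dof (nL κ Φ t p O.merged (gOf κ Φ t p O gv) (fOf κ Φ t p O fv)) (hL κ Φ t p O.merged (gOf κ Φ t p O gv) (fOf κ Φ t p O fv)) (ℓL κ Φ t p O.merged (gOf κ Φ t p O gv) (fOf κ Φ t p O fv))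 (vL κ Φ t p O.merged (gOf κ Φ t p O gv) (fOf κ Φ t p O fv))) (TwoAxis.Para.lam0 800 (vL κ Φ t p O.merged (gOf κ Φ t p O gv) (fOf κ Φ t p O fv)) (Skelφ.NegPrm.vβOf (nL κ Φ t p O.merged (gOf κ Φ t p O gv) (fOf κ Φ t p O fv)) (hL κ Φ t p O.merged (gOf κ Φ t p O gv) (fOf κ Φ t p O fv)) (ℓL κ Φ t p O.merged (gOf κ Φ t p O gv) (fOf κ Φ t p O fv)) (vL κ Φ t p O.merged (gOf κ Φ t p O gv) (fOf κ Φ t p O fv))) yY) +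
      (20 * (((fcells κ Φ t p O.merged (gOf κ Φ t p O gv) (fOf κ Φ t p O fv))).K : ℤ) * (((fcells κ Φ t p O.merged (gOf κ Φ t p O gv) (fOf κ Φ t p O fv))).s 0 : ℤ) * (800 * (TwoAxis.Para.modulus (nL κ Φ t p O.merged (gOf κ Φ t p O gv) (fOf κ Φ t p O fv)) (hL κ Φ t p O.merged (gOf κ Φ t p O gv) (fOf κ Φ t p O fv)) (vL κ Φ t p O.merged (gOf κ Φ t p O gv) (fOf κ Φ t p O fv)) (Skelφ.NegPrm.vβOf (nL κ Φ t p O.merged (gOf κ Φ t p O gv) (fOf κ Φ t p O fv)) (hL κ Φ t p O.merged (gOf κ Φ t p O gv) (fOf κ Φ t p O fv)) (ℓL κ Φ t p O.merged (gOf κ Φ t p O gv) (fOf κ Φ t p O fv)) (vL κ Φ t p O.merged (gOf κ Φ t p O gv) (fOf κ Φ t p O fv))) * (max (sgOf du * maLo) (sgOf du * maHi)) -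
        min ((vL κ Φ t p O.merged (gOf κ Φ t p O gv) (fOf κ Φ t p O fv)) * ((shearUnit (nL κ Φ t p O.merged (gOf κ Φ t p O gv) (fOf κ Φ t p O fv)) (hL κ Φ t p O.merged (gOf κ Φ t p O gv) (fOf κ Φ t p O fv)) : ℤ) * (min (sgOf du * mbLo) (sgOf du * mbHi) - 1))) ((vL κ Φ t p O.merged (gOf κ Φ t p O gv) (fOf κ Φ t p O fv)) * ((shearUnit (nL κ Φ t p O.merged (gOf κ Φ t p O gv) (fOf κ Φ t p O fv)) (hL κ Φ t p O.merged (gOf κ Φ t p O gv) (fOf κ Φ t p O fv)) : ℤ) * (max (sgOf du * mbLo) (sgOf du * mbHi)) + shearUnit (nL κ Φ t p O.merged (gOf κ Φ t p O gv) (fOf κ Φ t p O fv)) (hL κ Φ t p O.merged (gOf κ Φ t p O gv) (fOf κ Φ t p O fv)) - 1))) / (nL κ Φ t p O.merged (gOf κ Φ t p O gv) (fOf κ Φ t p O fv)))) / (Skelφ.NegPrm.Dof (nL κ Φ t p O.merged (gOf κ Φ t p O gv) (fOf κ Φ t p O fv)) (hL κ Φ t p O.merged (gOf κ Φ t p O gv)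 (fOf κ Φ t p O fv)) (ℓL κ Φ t p O.merged (gOf κ Φ t p O gv) (fOf κ Φ t p O fv)) (vL κ Φ t p O.merged (gOf κ Φ t p O gv) (fOf κ Φ t p O fv)))
        + 1 ≤ LHI 0)
    (hL2 : LLO 1 ≤ TwoAxis.Para.coarse (20 * (((fcells κ Φ t p O.merged (gOf κ Φ t p O gv) (fOf κ Φ t p O fv))).K : ℤ) * (((fcells κ Φ t p O.merged (gOf κ Φ t p O gv) (fOf κ Φ t p O fv))).s 1 : ℤ)) ((Skelφ.NegPrm.Dof (nL κ Φ t p O.merged (gOf κ Φ t p O gv) (fOf κ Φ t p O fv)) (hL κ Φ t p O.merged (gOf κ Φ t p O gv) (fOf κ Φ t p O fv)) (ℓL κ Φ t p O.merged (gOf κ Φ t p O gv) (fOf κ Φ t p O fv)) (vL κ Φ t p O.merged (gOf κ Φ t p O gv) (fOf κ Φ t p O fv))) / 2) (Skelφ.NegPrm.Dof (nL κ Φ t p O.merged (gOf κ Φ t p O gv) (fOf κ Φ t p O fv)) (hL κ Φ t p O.merged (gOf κ Φ t p O gv) (fOf κ Φ t p O fv)) (ℓL κ Φ t p O.merged (gOf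 κ Φ t p O gv) (fOf κ Φ t p O fv)) (vL κ Φ t p O.merged (gOf κ Φ t p O gv) (fOf κ Φ t p O fv))) (TwoAxis.Para.lam1 800 (nL κ Φ t p O.merged (gOf κ Φ t p O gv) (fOf κ Φ t p O fv)) (hL κ Φ t p O.merged (gOf κ Φ t p O gv) (fOf κ Φ t p O fv)) yY) + (20 * (((fcells κ Φ t p O.merged (gOf κ Φ t p O gv) (fOf κ Φ t p O fv))).K : ℤ) * (((fcells κ Φ t p O.merged (gOf κ Φ t p O gv) (fOf κ Φ t p O fv))).s 1 : ℤ) * (800 * ((shearUnit (nL κ Φ t p O.merged (gOf κ Φ t p O gv) (fOf κ Φ t p O fv)) (hL κ Φ t p O.merged (gOf κ Φ t p O gv) (fOf κ Φ t p O fv)) : ℤ) * (min (sgOf du * mbLo) (sgOf du * mbHi) - 1)))) / (Skelφ.NegPrm.Dof (nL κ Φ t p O.merged (gOf κ Φ t p O gv) (fOf κ Φ t p O fv)) (hL κ Φ t p O.merged (gOf κ Φ t p O gv) (fOf κ Φ t p O fv)) (ℓL κ Φ t p O.merged (gOf κ Φ t p O gv) (fOf κ Φ t p O fv)) (vL κ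 Φ t p O.merged (gOf κ Φ t p O gv) (fOf κ Φ t p O fv))))
    (hL3 : TwoAxis.Para.coarse (20 * (((fcells κ Φ t p O.merged (gOf κ Φ t p O gv) (fOf κ Φ t p O fv))).K : ℤ) * (((fcells κ Φ t p O.merged (gOf κ Φ t p O gv) (fOf κ Φ t p O fv))).s 1 : ℤ)) ((Skelφ.NegPrm.Dof (nL κ Φ t p O.merged (gOf κ Φ t p O gv) (fOf κ Φ t p O fv)) (hL κ Φ t p O.merged (gOf κ Φ t p O gv) (fOf κ Φ t p O fv)) (ℓL κ Φ t p O.merged (gOf κ Φ t p O gv) (fOf κ Φ t p O fv)) (vL κ Φ t p O.merged (gOf κ Φ t p O gv) (fOf κ Φ t p O fv))) / 2) (Skelφ.NegPrm.Dof (nL κ Φ t p O.merged (gOf κ Φ t p O gv) (fOf κ Φ t p O fv)) (hL κ Φ t p O.merged (gOf κ Φ t p O gv) (fOf κ Φ t p O fv)) (ℓL κ Φ t p O.merged (gOf κ Φ t p O gv) (fOf κ Φ t p O fv)) (vL κ Φ t p O.merged (gOf κ Φ t p O gv) (fOf κ Φ t p O fv))) (TwoAxis.Para.lam1 800 (nL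 κ Φ t p O.merged (gOf κ Φ t p O gv) (fOf κ Φ t p O fv)) (hL κ Φ t p O.merged (gOf κ Φ t p O gv) (fOf κ Φ t p O fv)) yY) +
      (20 * (((fcells κ Φ t p O.merged (gOf κ Φ t p O gv) (fOf κ Φ t p O fv))).K : ℤ) * (((fcells κ Φ t p O.merged (gOf κ Φ t p O gv) (fOf κ Φ t p O fv))).s 1 : ℤ) * (800 * ((shearUnit (nL κ Φ t p O.merged (gOf κ Φ t p O gv) (fOf κ Φ t p O fv)) (hL κ Φ t p O.merged (gOf κ Φ t p O gv) (fOf κ Φ t p O fv)) : ℤ) * (max (sgOf du * mbLo) (sgOf du * mbHi)) + shearUnit (nL κ Φ t p O.merged (gOf κ Φ t p O gv) (fOf κ Φ t p O fv)) (hL κ Φ t p O.merged (gOf κ Φ t p O gv) (fOf κ Φ t p O fv)) - 1))) / (Skelφ.NegPrm.Dof (nL κ Φ t p O.merged (gOf κ Φ t p O gv) (fOf κ Φ t p O fv)) (hL κ Φ t p O.merged (gOf κ Φ t p O gv) (fOf κ Φ t p O fv)) (ℓL κ Φ t p O.merged (gOf κ Φ t p O gv) (fOf κ Φ t p O fv))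 (vL κ Φ t p O.merged (gOf κ Φ t p O gv) (fOf κ Φ t p O fv))) + 1 ≤ LHI 1)
    (hLg₁ : sgOf du = 1 → 20 * (((fcells κ Φ t p O.merged (gOf κ Φ t p O gv) (fOf κ Φ t p O fv))).r du.1 : ℤ) - (b0T κ Φ t p O.merged (gOf κ Φ t p O gv) (fOf κ Φ t p O fv) du.1 : ℤ) + 1 ≤ LLO du.1 ∧
      LHI du.1 ≤ 20 * (((fcells κ Φ t p O.merged (gOf κ Φ t p O gv) (fOf κ Φ t p O fv))).r du.1 : ℤ) + (b0T κ Φ t p O.merged (gOf κ Φ t p O gv) (fOf κ Φ t p O fv) du.1 : ℤ) - 1)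
    (hLg₂ : sgOf du = -1 → 20 * (((fcells κ Φ t p O.merged (gOf κ Φ t p O gv) (fOf κ Φ t p O fv))).r du.1 : ℤ) - (b0T κ Φ t p O.merged (gOf κ Φ t p O gv) (fOf κ Φ t p O fv) du.1 : ℤ) + 1 ≤ -LHI du.1 ∧
      -LLO du.1 ≤ 20 * (((fcells κ Φ t p O.merged (gOf κ Φ t p O gv) (fOf κ Φ t p O fv))).r du.1 : ℤ) + (b0T κ Φ t p O.merged (gOf κ Φ t p O gv) (fOf κ Φ t p O fv) du.1 : ℤ) - 1)
    (hLg₃ : -((b0T κ Φ t p O.merged (gOf κ Φ t p O gv) (fOf κ Φ t p O fv) (oth du.1) : ℤ) - 1) ≤ LLO (oth du.1) ∧ LHI (oth du.1) ≤ (b0T κ Φ t p O.merged (gOf κ Φ t p O gv) (fOf κ Φ t p O fv) (oth du.1) : ℤ) - 1)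
    -- ROOM NUMBERS (d): the cross link, the clearances, the reaches inside the window; late thresholds inside the window; excess radii
    (hxa : ∀ x ∈ Finset.Icc B.core1Lo B.core1Hi, |x 0 - σu * yX 0| ≤ qX)
    (hxb : ∀ x ∈ Finset.Icc B.core1Lo B.core1Hi,
      |σu * (((nL κ Φ t p O.merged (gOf κ Φ t p O gv) (fOf κ Φ t p O fv)) : ℤ) * (x 1 - yX 1) - (hL κ Φ t p O.merged (gOf κ Φ t p O gv) (fOf κ Φ t p O fv)) * (σu * x 0 - yX 0))| + shearUnit (nL κ Φ t p O.merged (gOf κ Φ t p O gv) (fOf κ Φ t p O fv)) (hL κ Φ t p O.merged (gOf κ Φ t p O gv) (fOf κ Φ t p O fv)) ≤ (((nL κ Φ t p O.merged (gOf κ Φ t p O gv) (fOf κ Φ t p O fv)) * (ℓL κ Φ t p O.merged (gOf κ Φ t p O gv) (fOf κ Φ t p O fv)) / shearUnit (nL κ Φ t p O.merged (gOf κ Φ t p O gv) (fOf κ Φ t p O fv)) (hL κ Φ t p O.merged (gOf κ Φ t p O gv) (fOf κ Φ t p O fv)) + 1 : ℕ) : ℤ) * shearUnit (nL κ Φ t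 p O.merged (gOf κ Φ t p O gv) (fOf κ Φ t p O fv)) (hL κ Φ t p O.merged (gOf κ Φ t p O gv) (fOf κ Φ t p O fv)))
    (hclr : (O.merged.k : ℤ) < σu * yX 0 - qX - KS.RA' κ Φ t p O.merged mk - (((nL κ Φ t p O.merged (gOf κ Φ t p O gv) (fOf κ Φ t p O fv)) : ℕ) : ℤ)) (hRn : KS.RA' κ Φ t p O.merged mk ≤ (nL κ Φ t p O.merged (gOf κ Φ t p O gv) (fOf κ Φ t p O fv)))
    (hclr₁ : (O.merged.k : ℤ) < B.B₀lo 0 - B.R' - B.pr)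
    (hπ1 : (B.core1Lo 0).natAbs + (B.core1Lo 1).natAbs ≤ Rπ) (hπ2 : (yX 0).natAbs + (yX 1).natAbs + (Nx + 1) * shearUnit (nL κ Φ t p O.merged (gOf κ Φ t p O gv) (fOf κ Φ t p O fv)) (hL κ Φ t p O.merged (gOf κ Φ t p O gv) (fOf κ Φ t p O fv)) ≤ Rπ)
    -- ROOM NUMBERS (d′): the y′-leg — x-clearance of every y′-region (`InRegion`'s transverse bounds; B.17: `σu := sgOf du · sgn⁺ v_L`), cross link, reach
    (hclrY : ∀ k ≤ Ny, ∀ b : ℤ, (yPrmW (nL κ Φ t p O.merged (gOf κ Φ t p O gv) (fOf κ Φ t p O fv)) (ℓL κ Φ t p O.merged (gOf κ Φ t p O gv) (fOf κ Φ t p O fv)) (hL κ Φ t p O.merged (gOf κ Φ t p O gv) (fOf κ Φ t p O fv)) (vL κ Φ t p O.merged (gOf κ Φ t p O gv) (fOf κ Φ t p O fv)) (KS.RA' κ Φ t p O.merged mk) qY Ny).bLo k - KS.RA' κ Φ t p O.merged mk - (nL κ Φ t p O.merged (gOf κ Φ t p O gv) (fOf κ Φ t p O fv)) ≤ b →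
      b ≤ (yPrmW (nL κ Φ t p O.merged (gOf κ Φ t p O gv) (fOf κ Φ t p O fv)) (ℓL κ Φ t p O.merged (gOf κ Φ t p O gv) (fOf κ Φ t p O fv)) (hL κ Φ t p O.merged (gOf κ Φ t p O gv) (fOf κ Φ t p O fv)) (vL κ Φ t p O.merged (gOf κ Φ t p O gv) (fOf κ Φ t p O fv)) (KS.RA' κ Φ t p O.merged mk) qY Ny).bHi k + KS.RA' κ Φ t p O.merged mk + (nL κ Φ t p O.merged (gOf κ Φ t p O gv) (fOf κ Φ t p O fv)) → (O.merged.k : ℤ) < σu * sgOf du * b + σu * yY 0)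
    (hx₂₃ : ∀ r : Site 2, Skelφ.pt (r 0 - σu * yX 0) ((σu * (((nL κ Φ t p O.merged (gOf κ Φ t p O gv) (fOf κ Φ t p O fv)) : ℤ) * (r 1 - yX 1) - (hL κ Φ t p O.merged (gOf κ Φ t p O gv) (fOf κ Φ t p O fv)) * (σu * r 0 - yX 0))) / (shearUnit (nL κ Φ t p O.merged (gOf κ Φ t p O gv) (fOf κ Φ t p O fv)) (hL κ Φ t p O.merged (gOf κ Φ t p O gv) (fOf κ Φ t p O fv)) : ℤ)) ∈
        (xRunSched (nL κ Φ t p O.merged (gOf κ Φ t p O gv) (fOf κ Φ t p O fv)) (ℓL κ Φ t p O.merged (gOf κ Φ t p O gv) (fOf κ Φ t p O fv)) (hL κ Φ t p O.merged (gOf κ Φ t p O gv) (fOf κ Φ t p O fv)) (KS.RA' κ Φ t p O.merged mk) qX Nx).core (Nx + 1) →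
      Skelφ.pt ((sgOf du * (((nL κ Φ t p O.merged (gOf κ Φ t p O gv) (fOf κ Φ t p O fv)) : ℤ) * (r 1 - yY 1) - (hL κ Φ t p O.merged (gOf κ Φ t p O gv) (fOf κ Φ t p O fv)) * (σu * r 0 - yY 0))) / (shearUnit (nL κ Φ t p O.merged (gOf κ Φ t p O gv) (fOf κ Φ t p O fv)) (hL κ Φ t p O.merged (gOf κ Φ t p O gv) (fOf κ Φ t p O fv)) : ℤ)) (sgOf du * (σu * r 0 - yY 0)) ∈ (yRunSched (one_le_nL_of_atQOS (atQOS_of_atQOT hAt)) (abs_vL_le_of_atQOS (atQOS_of_atQOT hAt)) (layer_of_atQOS (atQOS_of_atQOT hAt)) (KS.RA' κ Φ t p O.merged mk) qY Ny).core 0)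
    (hπ3 : ∀ k ≤ Ny, (yY 0).natAbs + (yY 1).natAbs + (((((k + 1 : ℕ) : ℤ) * (vL κ Φ t p O.merged (gOf κ Φ t p O gv) (fOf κ Φ t p O fv))).natAbs +
      (((shearUnit (nL κ Φ t p O.merged (gOf κ Φ t p O gv) (fOf κ Φ t p O fv)) (hL κ Φ t p O.merged (gOf κ Φ t p O gv) (fOf κ Φ t p O fv)) : ℤ) * |((k + 1 : ℕ) : ℤ) * (yPrmW (nL κ Φ t p O.merged (gOf κ Φ t p O gv) (fOf κ Φ t p O fv)) (ℓL κ Φ t p O.merged (gOf κ Φ t p O gv) (fOf κ Φ t p O fv)) (hL κ Φ t p O.merged (gOf κ Φ t p O gv) (fOf κ Φ t p O fv)) (vL κ Φ t p O.merged (gOf κ Φ t p O gv) (fOf κ Φ t p O fv)) (KS.RA' κ Φ t p O.merged mk) qY Ny).sLo| + |(hL κ Φ t p O.merged (gOf κ Φ t p O gv) (fOf κ Φ t p O fv))| * |((k + 1 : ℕ) : ℤ) * (vL κ Φ t p O.merged (gOf κ Φ t p O gv) (fOf κ Φ t p O fv))| + shearUnit (nL κ Φ t p O.merged (gOf κ Φ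 t p O gv) (fOf κ Φ t p O fv)) (hL κ Φ t p O.merged (gOf κ Φ t p O gv) (fOf κ Φ t p O fv))) / (nL κ Φ t p O.merged (gOf κ Φ t p O gv) (fOf κ Φ t p O fv))).natAbs + 1)) ≤ Rπ)
    (hclrz : (Mu O.merged + 4) * ((nL κ Φ t p O.merged (gOf κ Φ t p O gv) (fOf κ Φ t p O fv)) + ((hL κ Φ t p O.merged (gOf κ Φ t p O gv) (fOf κ Φ t p O fv))).natAbs) ≤ (nL κ Φ t p O.merged (gOf κ Φ t p O gv) (fOf κ Φ t p O fv)) * ((ℓL κ Φ t p O.merged (gOf κ Φ t p O gv) (fOf κ Φ t p O fv)) + 1))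
    (hRb₀ : KS.r₀A Φ t O.merged mk Rb ≤ Rπ) (hRr₀ : KS.r₀A Φ t O.merged mk (O.merged.R (O.merged.scale t (ML κ Φ t p O.merged (gOf κ Φ t p O gv)) (nL κ Φ t p O.merged (gOf κ Φ t p O gv) (fOf κ Φ t p O fv)))) ≤ Rπ) (hRbπ : Rb ≤ Rπ)
    (hR₁b : Rex κ Φ (mR κ Φ t p O.merged (gOf κ Φ t p O gv) (fOf κ Φ t p O fv) mx) q (Skelφ.fatRadius Φ.frame hC O.merged.k) ≤ Rπ - KS.r₀A Φ t O.merged mk Rb)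
    (hR₁r : Rex κ Φ (mR κ Φ t p O.merged (gOf κ Φ t p O gv) (fOf κ Φ t p O fv) mx) q (Skelφ.fatRadius Φ.frame hC O.merged.k) ≤ Rπ - KS.r₀A Φ t O.merged mk (O.merged.R (O.merged.scale t (ML κ Φ t p O.merged (gOf κ Φ t p O gv)) (nL κ Φ t p O.merged (gOf κ Φ t p O gv) (fOf κ Φ t p O fv))))) :
    Skel.RootOblTWAt G ((choiceAtOT κ Φ t p gv fv Sv hC Pv).scheme O q) Φ.Δ κ.δr du := by
  have hAtS := atQOS_of_atQOT hAt
  obtain ⟨hF, hq1, hq2, hCq⟩ := factsO_of_atQOS hAtS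
  have hAtB := atQOB_of_atQOS hAtS
  obtain ⟨hm₀k, hk1, hkM₀, hReq, hΛeq⟩ := hF.seed
  have hσ : sgOf du = 1 ∨ sgOf du = -1 := sgOf_sign du
  have hEqL := clauseL_of_atQOS hAtS
  have hNL : EqNumL κ Φ t p O.merged (gOf κ Φ t p O gv) (fOf κ Φ t p O fv) := eqNumL_of_atQOS hAtS
  obtain ⟨hnL, hℓL⟩ := one_le_of_eqNumL κ Φ t p O.merged (gOf κ Φ t p O gv) (fOf κ Φ t p O fv) hNL
  have hκL : ((hL κ Φ t p O.merged (gOf κ Φ t p O gv) (fOf κ Φ t p O fv))).natAbs ≤ 10 * (nL κ Φ t p O.merged (gOf κ Φ t p O gv) (fOf κ Φ t p O fv)) := hEqL.2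
  have hκL10 : |(hL κ Φ t p O.merged (gOf κ Φ t p O gv) (fOf κ Φ t p O fv))| ≤ 10 * (((nL κ Φ t p O.merged (gOf κ Φ t p O gv) (fOf κ Φ t p O fv)) : ℕ) : ℤ) := by rw [← Int.natCast_natAbs]; exact_mod_cast hκL
  have hlip : Skelφ.Lip G (φL κ Φ t p O.D O.DT O.ori (gOf κ Φ t p O gv) (fOf κ Φ t p O fv)) := lip_φL κ Φ t p O.D O.DT O.ori (gOf κ Φ t p O gv) (fOf κ Φ t p O fv)
  have hstep : Skelφ.Steps G (φL κ Φ t p O.D O.DT O.ori (gOf κ Φ t p O gv) (fOf κ Φ t p O fv)) := steps_φL κ Φ t p O.D O.DT O.ori (gOf κ Φ t p O gv) (fOf κ Φ t p O fv)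
  have hfr : Skelφ.Frames G (φL κ Φ t p O.D O.DT O.ori (gOf κ Φ t p O gv) (fOf κ Φ t p O fv)) Φ.types := Skelφ.frames_oriφ Φ.frame _
  have hκc : Skelφ.CylConn G (φL κ Φ t p O.D O.DT O.ori (gOf κ Φ t p O gv) (fOf κ Φ t p O fv)) Φ.types := Skelφ.cylConn_oriφ Φ.cyl_connected _
  have hAf : (0 : ℤ) ≤ 800 := by norm_num
  have hmf : 0 ≤ TwoAxis.Para.modulus (nL κ Φ t p O.merged (gOf κ Φ t p O gv) (fOf κ Φ t p O fv)) (hL κ Φ t p O.merged (gOf κ Φ t p O gv) (fOf κ Φ t p O fv)) (vL κ Φ t p O.merged (gOf κ Φ t p O gv) (fOf κ Φ t p O fv)) (Skelφ.NegPrm.vβOf (nL κ Φ t p O.merged (gOf κ Φ t p O gv) (fOf κ Φ t p O fv)) (hL κ Φ t p O.merged (gOf κ Φ t p O gv) (fOf κ Φ t p O fv)) (ℓL κ Φ t p O.merged (gOf κ Φ t p O gv) (fOf κ Φ t p O fv)) (vL κ Φ t p O.merged (gOf κ Φ t p O gv) (fOf κ Φ t p O fv))) := (Skelφ.NegPrm.modulus_vβOf_pos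 hnL hℓL _ _).le
  have hc0 := Skelφ.NegPrm.c_nonneg ((fcells κ Φ t p O.merged (gOf κ Φ t p O gv) (fOf κ Φ t p O fv))) 0
  have hc1 := Skelφ.NegPrm.c_nonneg ((fcells κ Φ t p O.merged (gOf κ Φ t p O gv) (fOf κ Φ t p O fv))) 1
  have hDf : 0 < (Skelφ.NegPrm.Dof (nL κ Φ t p O.merged (gOf κ Φ t p O gv) (fOf κ Φ t p O fv)) (hL κ Φ t p O.merged (gOf κ Φ t p O gv) (fOf κ Φ t p O fv)) (ℓL κ Φ t p O.merged (gOf κ Φ t p O gv) (fOf κ Φ t p O fv)) (vL κ Φ t p O.merged (gOf κ Φ t p O gv) (fOf κ Φ t p O fv))) := Skelφ.NegPrm.Dof_pos hnL hℓL _ _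
  let FS := Skelφ.fineSkel (φL κ Φ t p O.D O.DT O.ori (gOf κ Φ t p O gv) (fOf κ Φ t p O fv)) t 800 (nL κ Φ t p O.merged (gOf κ Φ t p O gv) (fOf κ Φ t p O fv)) (hL κ Φ t p O.merged (gOf κ Φ t p O gv) (fOf κ Φ t p O fv)) (vL κ Φ t p O.merged (gOf κ Φ t p O gv) (fOf κ Φ t p O fv)) (Skelφ.NegPrm.vβOf (nL κ Φ t p O.merged (gOf κ Φ t p O gv) (fOf κ Φ t p O fv)) (hL κ Φ t p O.merged (gOf κ Φ t p O gv) (fOf κ Φ t p O fv)) (ℓL κ Φ t p O.merged (gOf κ Φ t p O gv) (fOf κ Φ t p O fv)) (vL κ Φ t p O.merged (gOf κ Φ t p O gv) (fOf κ Φ t p O fv))) (20 * (((fcells κ Φ t p O.merged (gOf κ Φ t p O gv) (fOf κ Φ t p O fv))).K : ℤ) * (((fcells κ Φ t p O.merged (gOf κ Φ t p O gv) (fOf κ Φ t p O fv))).s 0 : ℤ)) (20 * (((fcells κ Φ t p O.merged (gOf κ Φ t p O gv) (fOf κ Φ t p O fv))).K : ℤ) * (((fcells κ Φ t p O.merged (gOf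 κ Φ t p O gv) (fOf κ Φ t p O fv))).s 1 : ℤ)) ((Skelφ.NegPrm.Dof (nL κ Φ t p O.merged (gOf κ Φ t p O gv) (fOf κ Φ t p O fv)) (hL κ Φ t p O.merged (gOf κ Φ t p O gv) (fOf κ Φ t p O fv)) (ℓL κ Φ t p O.merged (gOf κ Φ t p O gv) (fOf κ Φ t p O fv)) (vL κ Φ t p O.merged (gOf κ Φ t p O gv) (fOf κ Φ t p O fv))) / 2) ((Skelφ.NegPrm.Dof (nL κ Φ t p O.merged (gOf κ Φ t p O gv) (fOf κ Φ t p O fv)) (hL κ Φ t p O.merged (gOf κ Φ t p O gv) (fOf κ Φ t p O fv)) (ℓL κ Φ t p O.merged (gOf κ Φ t p O gv) (fOf κ Φ t p O fv)) (vL κ Φ t p O.merged (gOf κ Φ t p O gv) (fOf κ Φ t p O fv))) / 2) (Skelφ.NegPrm.Dof (nL κ Φ t p O.merged (gOf κ Φ t p O gv) (fOf κ Φ t p O fv)) (hL κ Φ t p O.merged (gOf κ Φ t p O gv) (fOf κ Φ t p O fv)) (ℓL κ Φ t p O.merged (gOf κ Φ t p O gv) (fOf κ Φ t p O fv)) (vL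 κ Φ t p O.merged (gOf κ Φ t p O gv) (fOf κ Φ t p O fv)))
  have hfine : fineO κ Φ t p O.D O.DT O.ori (gOf κ Φ t p O gv) (fOf κ Φ t p O fv) = FS := rfl
  have hlipF : Skelφ.Lip G (fineO κ Φ t p O.D O.DT O.ori (gOf κ Φ t p O gv) (fOf κ Φ t p O fv)) := lip_fine_at κ Φ t p O.merged (gOf κ Φ t p O gv) (fOf κ Φ t p O fv) hlip hNL
  have hwsF : Skelφ.WeakSteps G (fineO κ Φ t p O.D O.DT O.ori (gOf κ Φ t p O gv) (fOf κ Φ t p O fv)) := weakSteps_fine_at κ Φ t p O.merged (gOf κ Φ t p O gv) (fOf κ Φ t p O fv) hstep hNL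
  let S : KSchA V ℕ := (choiceAtOT κ Φ t p gv fv Sv hC Pv).scheme O q
  have hroot : S.Γ.root = t := rfl
  let Λs := schedOf κ Φ t p O.merged (gOf κ Φ t p O gv) (fOf κ Φ t p O fv) (Sv κ Φ t p O.merged (gOf κ Φ t p O gv) (fOf κ Φ t p O fv) q)
  have hUfoot : ∀ w ∈ graphBall G t Rπ, FootBox (-(5 * (((fcells κ Φ t p O.merged (gOf κ Φ t p O gv) (fOf κ Φ t p O fv))).r du.1 : ℤ)) + 1) (25 * (((fcells κ Φ t p O.merged (gOf κ Φ t p O gv) (fOf κ Φ t p O fv))).r du.1 : ℤ) - 1) (5 * (((fcells κ Φ t p O.merged (gOf κ Φ t p O gv) (fOf κ Φ t p O fv))).r (oth du.1) : ℤ) - 2) du (FS w) →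
      w ∈ S.U0root du := by
    intro w hw hfb
    rw [← hfine] at hfb
    exact Skelφ.mem_U0rootb_of_footprint ((fcells κ Φ t p O.merged (gOf κ Φ t p O gv) (fOf κ Φ t p O fv))) t Λs du (b0T κ Φ t p O.merged (gOf κ Φ t p O gv) (fOf κ Φ t p O fv)) q κ.δ hlipF hwsF hRQ hRB hRQ' hw hfb.1 hfb.2.1 hfb.2.2
  have hMfoot : ∀ w ∈ graphBall G t Rπ, FootBox (20 * (((fcells κ Φ t p O.merged (gOf κ Φ t p O gv) (fOf κ Φ t p O fv))).r du.1 : ℤ) - (b0T κ Φ t p O.merged (gOf κ Φ t p O gv) (fOf κ Φ t p O fv) du.1 : ℤ) + 1)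
      (20 * (((fcells κ Φ t p O.merged (gOf κ Φ t p O gv) (fOf κ Φ t p O fv))).r du.1 : ℤ) + (b0T κ Φ t p O.merged (gOf κ Φ t p O gv) (fOf κ Φ t p O fv) du.1 : ℤ) - 1) ((b0T κ Φ t p O.merged (gOf κ Φ t p O gv) (fOf κ Φ t p O fv) (oth du.1) : ℤ) - 1) du (FS w) →
      w ∈ S.Γ.M S.Γ.a₀ ((0 : Site 2) + stepVec du) := by
    intro w hw hfb
    rw [← hfine] at hfb
    have ha : |sgOf du * (fineO κ Φ t p O.D O.DT O.ori (gOf κ Φ t p O gv) (fOf κ Φ t p O fv) w) du.1 - 20 * (((fcells κ Φ t p O.merged (gOf κ Φ t p O gv) (fOf κ Φ t p O fv))).r du.1 : ℤ)| ≤ (b0T κ Φ t p O.merged (gOf κ Φ t p O gv) (fOf κ Φ t p O fv) du.1 : ℤ) - 1 :=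
      abs_le.2 ⟨by linarith [hfb.1], by linarith [hfb.2.1]⟩
    exact Skelφ.mem_rootMb_of_footprint ((fcells κ Φ t p O.merged (gOf κ Φ t p O gv) (fOf κ Φ t p O fv))) t Λs du (b0T κ Φ t p O.merged (gOf κ Φ t p O gv) (fOf κ Φ t p O fv)) hlipF hwsF hRM hw ha hfb.2.2
  -- the root world's planar diameter in `φL` (located (L-R1)): fine diameter `≤ 40·rmax ≤ 50·rmax`, converted by `fine_diam_le_mR`
  have hUm : ∀ d ∈ S.U0root du, ∀ d' ∈ S.U0root du, (φL κ Φ t p O.D O.DT O.ori (gOf κ Φ t p O gv) (fOf κ Φ t p O fv)) d - (φL κ Φ t p O.D O.DT O.ori (gOf κ Φ t p O gv) (fOf κ Φ t p O fv)) d' ∈ box 2 (mR κ Φ t p O.merged (gOf κ Φ t p O gv) (fOf κ Φ t p O fv) mx) := by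
    intro d hd d' hd'
    have h := Skelφ.ψ_sub_mem_box_of_mem_U0rootb ((fcells κ Φ t p O.merged (gOf κ Φ t p O gv) (fOf κ Φ t p O fv))) t Λs q κ.δ du (b0T κ Φ t p O.merged (gOf κ Φ t p O gv) (fOf κ Φ t p O fv)) hd hd'
    have h' : fineO κ Φ t p O.D O.DT O.ori (gOf κ Φ t p O gv) (fOf κ Φ t p O fv) d - fineO κ Φ t p O.D O.DT O.ori (gOf κ Φ t p O gv) (fOf κ Φ t p O fv) d' ∈ box 2 (50 * ((fcells κ Φ t p O.merged (gOf κ Φ t p O gv) (fOf κ Φ t p O fv))).rmax) :=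
      box_mono 2 (show 40 * ((fcells κ Φ t p O.merged (gOf κ Φ t p O gv) (fOf κ Φ t p O fv))).rmax ≤ 50 * ((fcells κ Φ t p O.merged (gOf κ Φ t p O gv) (fOf κ Φ t p O fv))).rmax by omega) h
    exact fine_diam_le_mR κ Φ t p O.merged (gOf κ Φ t p O gv) (fOf κ Φ t p O fv) mx hNL h'
  let A : Finset V := O.merged.Λ t O.merged.k
  have hAfat : A = Skelφ.fatSeq Φ.frame hC t O.merged.k := by show O.merged.Λ t O.merged.k = _; rw [hΛeq]
  have htA : t ∈ A := by
    rw [hAfat, Skelφ.mem_fatSeq_iff]; exact Skelφ.self_mem_cylBall G Φ.φ t _ _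
  have hAconn : ∀ a ∈ A, PathIn G (↑A : Set V) t a := by
    rw [hAfat, ← Skelφ.fatSeqOff_zero]; exact Skelφ.pathIn_fatSeqOff Φ.frame hC 0 t _
  have hAρ : ∀ a ∈ A, a ∈ graphBall G t (Skelφ.fatRadius Φ.frame hC O.merged.k) := by
    intro a ha
    rw [hAfat, Skelφ.mem_fatSeq_iff] at ha
    exact (Skelφ.cylBall_subset_prism G Φ.φ t _ _ ha).1
  have hAbox : ∀ a ∈ A, |(φL κ Φ t p O.D O.DT O.ori (gOf κ Φ t p O gv) (fOf κ Φ t p O fv)) a 0 - (φL κ Φ t p O.D O.DT O.ori (gOf κ Φ t p O gv) (fOf κ Φ t p O fv)) t 0| ≤ (O.merged.k : ℤ) ∧ |(φL κ Φ t p O.D O.DT O.ori (gOf κ Φ t p O gv) (fOf κ Φ t p O fv)) a 1 - (φL κ Φ t p O.D O.DT O.ori (gOf κ Φ t p O gv) (fOf κ Φ t p O fv)) t 1| ≤ (O.merged.k : ℤ) := by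
    intro a ha
    have hc : a ∈ Skelφ.cyl Φ.φ t O.merged.k := by
      rw [hAfat] at ha; exact Skelφ.fatSeq_subset_cyl Φ.frame hC t _ (Finset.mem_coe.2 ha)
    have hc' : a ∈ Skelφ.cyl (φL κ Φ t p O.D O.DT O.ori (gOf κ Φ t p O gv) (fOf κ Φ t p O fv)) t O.merged.k := by unfold NegB.φL; rwa [Skelφ.cyl_oriφ]
    rw [Skelφ.mem_cyl, mem_box] at hc'
    have h0 := hc' 0; have h1 := hc' 1
    simp only [Pi.sub_apply] at h0 h1
    exact ⟨abs_le.2 ⟨h0.1, h0.2⟩, abs_le.2 ⟨h1.1, h1.2⟩⟩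
  have hAφ : ∀ a ∈ A, |(φL κ Φ t p O.D O.DT O.ori (gOf κ Φ t p O gv) (fOf κ Φ t p O fv)) a 0 - (φL κ Φ t p O.D O.DT O.ori (gOf κ Φ t p O gv) (fOf κ Φ t p O fv)) t 0| ≤ ((O.merged.k : ℕ) : ℤ) := fun a ha => (hAbox a ha).1
  have hAQ : A ⊆ S.Γ.Q S.Γ.a₀ 0 := by
    intro a ha
    obtain ⟨h0, h1⟩ := hAbox a ha
    obtain ⟨k0, k1⟩ := Skelφ.abs_fineSkel_le_of_near (φ := (φL κ Φ t p O.D O.DT O.ori (gOf κ Φ t p O gv) (fOf κ Φ t p O fv))) t hDf hc0 hc1 hkA0 hkA1 h0 h1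
    have hall : ∀ i : Fin 2, |(FS a) i| ≤ kA := fun i => by
      fin_cases i
      · exact k0
      · exact k1
    have hs : |sgOf du * (FS a) du.1| ≤ kA := by
      rw [abs_mul, show |sgOf du| = 1 by rcases hσ with h | h <;> simp [h], one_mul]; exact hall du.1
    have hs' := abs_le.1 hs
    have h₁ : -(5 * (((fcells κ Φ t p O.merged (gOf κ Φ t p O gv) (fOf κ Φ t p O fv))).r du.1 : ℤ)) + 1 ≤ sgOf du * (fineO κ Φ t p O.D O.DT O.ori (gOf κ Φ t p O gv) (fOf κ Φ t p O fv) a) du.1 := by rw [hfine]; linarith [hs'.1, hkAQ.1]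
    have h₂ : sgOf du * (fineO κ Φ t p O.D O.DT O.ori (gOf κ Φ t p O gv) (fOf κ Φ t p O fv) a) du.1 ≤ 5 * (((fcells κ Φ t p O.merged (gOf κ Φ t p O gv) (fOf κ Φ t p O fv))).r du.1 : ℤ) := by rw [hfine]; linarith [hs'.2, hkAQ.1]
    have h₃ : |(fineO κ Φ t p O.D O.DT O.ori (gOf κ Φ t p O gv) (fOf κ Φ t p O fv) a) (oth du.1)| ≤ 5 * (((fcells κ Φ t p O.merged (gOf κ Φ t p O gv) (fOf κ Φ t p O fv))).r (oth du.1) : ℤ) - 1 := by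
      rw [hfine]; exact (hall (oth du.1)).trans (by linarith [hkAQ.2])
    have hmem := Skelφ.mem_rootQ_of_footprint ((fcells κ Φ t p O.merged (gOf κ Φ t p O gv) (fOf κ Φ t p O fv))) t Λs du hlipF hwsF hRQ (graphBall_mono G t hρπ (hAρ a ha)) h₁ h₂ h₃
    change a ∈ (Skelφ.cellGeomSG₂b G (fineO κ Φ t p O.D O.DT O.ori (gOf κ Φ t p O gv) (fOf κ Φ t p O fv)) ((fcells κ Φ t p O.merged (gOf κ Φ t p O gv) (fOf κ Φ t p O fv))) t Λs (b0T κ Φ t p O.merged (gOf κ Φ t p O gv) (fOf κ Φ t p O fv))).Q 0 0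
    rw [Skelφ.cellGeomSG₂b_Q]; exact hmem
  obtain ⟨cX, hcXπ, hcX⟩ := Skelφ.exists_mem_graphBall_φ_eq hstep t ((φL κ Φ t p O.D O.DT O.ori (gOf κ Φ t p O gv) (fOf κ Φ t p O fv)) t + yX)
  have hcXπ' : cX ∈ graphBall G t ((yX 0).natAbs + (yX 1).natAbs) := by
    simpa only [Pi.add_apply, add_sub_cancel_left] using hcXπ
  obtain ⟨cY, hcYπ, hcY⟩ := Skelφ.exists_mem_graphBall_φ_eq hstep t ((φL κ Φ t p O.D O.DT O.ori (gOf κ Φ t p O gv) (fOf κ Φ t p O fv)) t + yY)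
  have hcYπ' : cY ∈ graphBall G t ((yY 0).natAbs + (yY 1).natAbs) := by
    simpa only [Pi.add_apply, add_sub_cancel_left] using hcYπ
  have hRA := KS.RA'_eq κ Φ t p O.merged mk
  have hRl₁ : KS.RlevA κ Φ t p O.merged mk + 1 ≤ B.R' := hRA.2.1 ▸ hBR'
  have hRl₂ : KS.RlevA κ Φ t p O.merged mk + 1 ≤ KS.RA' κ Φ t p O.merged mk := hRA.2.1.le
  have hj : KS.j₁A κ Φ t p O.merged mk ≤ KS.RlevA κ Φ t p O.merged mk := hRA.2.2
  let Pb : Skelφ.ApronPrm := KS.apron Φ t O.merged mk ((Mu O.merged : ℤ) + 2) (KS.r₀A Φ t O.merged mk Rb)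
  let Pr : Skelφ.ApronPrm := KS.apron Φ t O.merged mk ((Mu O.merged + 1 : ℕ) * (shearUnit (nL κ Φ t p O.merged (gOf κ Φ t p O gv) (fOf κ Φ t p O fv)) (hL κ Φ t p O.merged (gOf κ Φ t p O gv) (fOf κ Φ t p O fv)) : ℤ) + 1) (KS.r₀A Φ t O.merged mk (O.merged.R (O.merged.scale t (ML κ Φ t p O.merged (gOf κ Φ t p O gv)) (nL κ Φ t p O.merged (gOf κ Φ t p O gv) (fOf κ Φ t p O fv)))))
  obtain ⟨hPNb, hd1b, hD1b, hD2b, hDρb, hℓb, hWb, hKmaxb, hKCmaxb, hR'b, hTb, hT'b⟩ :=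
    KS.apron_ok Φ t O.merged mk ((Mu O.merged : ℤ) + 2) (KS.r₀A Φ t O.merged mk Rb) (c := 1) (by norm_num)
  obtain ⟨hPNr, hd1r, hD1r, hD2r, hDρr, hℓr, hWr, hKmaxr, hKCmaxr, hR'r, hTr, hT'r⟩ :=
    KS.apron_ok Φ t O.merged mk ((Mu O.merged + 1 : ℕ) * (shearUnit (nL κ Φ t p O.merged (gOf κ Φ t p O gv) (fOf κ Φ t p O fv)) (hL κ Φ t p O.merged (gOf κ Φ t p O gv) (fOf κ Φ t p O fv)) : ℤ) + 1) (KS.r₀A Φ t O.merged mk (O.merged.R (O.merged.scale t (ML κ Φ t p O.merged (gOf κ Φ t p O gv)) (nL κ Φ t p O.merged (gOf κ Φ t p O gv) (fOf κ Φ t p O fv))))) (c := 11) le_rfl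
  obtain ⟨hrsb, hcSb⟩ := KS.apron_sizes Φ t O.merged mk ((Mu O.merged : ℤ) + 2) (KS.r₀A Φ t O.merged mk Rb)
  obtain ⟨hrsr, hcSr⟩ := KS.apron_sizes Φ t O.merged mk ((Mu O.merged + 1 : ℕ) * (shearUnit (nL κ Φ t p O.merged (gOf κ Φ t p O gv) (fOf κ Φ t p O fv)) (hL κ Φ t p O.merged (gOf κ Φ t p O gv) (fOf κ Φ t p O fv)) : ℤ) + 1) (KS.r₀A Φ t O.merged mk (O.merged.R (O.merged.scale t (ML κ Φ t p O.merged (gOf κ Φ t p O gv)) (nL κ Φ t p O.merged (gOf κ Φ t p O gv) (fOf κ Φ t p O fv)))))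
  have hr₀b := KS.hr₀_apron Φ t O.merged mk ((Mu O.merged : ℤ) + 2) (KS.r₀A_ge Φ t O.merged mk Rb).1
  have hr₀r := KS.hr₀_apron Φ t O.merged mk ((Mu O.merged + 1 : ℕ) * (shearUnit (nL κ Φ t p O.merged (gOf κ Φ t p O gv) (fOf κ Φ t p O fv)) (hL κ Φ t p O.merged (gOf κ Φ t p O gv) (fOf κ Φ t p O fv)) : ℤ) + 1) (KS.r₀A_ge Φ t O.merged mk (O.merged.R (O.merged.scale t (ML κ Φ t p O.merged (gOf κ Φ t p O gv)) (nL κ Φ t p O.merged (gOf κ Φ t p O gv) (fOf κ Φ t p O fv))))).1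
  have hreachb := KS.hreach_apron Φ t O.merged mk ((Mu O.merged : ℤ) + 2) (KS.r₀A_ge Φ t O.merged mk Rb).2
  have hreachr := KS.hreach_apron Φ t O.merged mk ((Mu O.merged + 1 : ℕ) * (shearUnit (nL κ Φ t p O.merged (gOf κ Φ t p O gv) (fOf κ Φ t p O fv)) (hL κ Φ t p O.merged (gOf κ Φ t p O gv) (fOf κ Φ t p O fv)) : ℤ) + 1) (KS.r₀A_ge Φ t O.merged mk (O.merged.R (O.merged.scale t (ML κ Φ t p O.merged (gOf κ Φ t p O gv)) (nL κ Φ t p O.merged (gOf κ Φ t p O gv) (fOf κ Φ t p O fv))))).2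
  have hR'b' : Skelφ.cylRadMax G (φL κ Φ t p O.D O.DT O.ori (gOf κ Φ t p O gv) (fOf κ Φ t p O fv)) Φ.types Pb.ℓ (KS.Rs t O.merged mk + KS.KCmax t O.merged mk + (Pb.W + KS.Kmax t O.merged mk)) ≤ Pb.R' := by
    unfold NegB.φL; rw [Skelφ.cylRadMax_oriφ]; exact hR'b
  have hR'r' : Skelφ.cylRadMax G (φL κ Φ t p O.D O.DT O.ori (gOf κ Φ t p O gv) (fOf κ Φ t p O fv)) Φ.types Pr.ℓ (KS.Rs t O.merged mk + KS.KCmax t O.merged mk + (Pr.W + KS.Kmax t O.merged mk)) ≤ Pr.R' := by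
    unfold NegB.φL; rw [Skelφ.cylRadMax_oriφ]; exact hR'r
  let SN := xRunSched (nL κ Φ t p O.merged (gOf κ Φ t p O gv) (fOf κ Φ t p O fv)) (ℓL κ Φ t p O.merged (gOf κ Φ t p O gv) (fOf κ Φ t p O fv)) (hL κ Φ t p O.merged (gOf κ Φ t p O gv) (fOf κ Φ t p O fv)) (KS.RA' κ Φ t p O.merged mk) qX Nx
  let SY := yRunSched (one_le_nL_of_atQOS hAtS) (abs_vL_le_of_atQOS hAtS) (layer_of_atQOS hAtS) (KS.RA' κ Φ t p O.merged mk) qY Ny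
  have hLb := fun {j : ℕ} (hj : KS.j₀A t O.merged mk ≤ j) => rootKit_levels Φ t O.merged mk ((Mu O.merged : ℤ) + 2) (KS.r₀A Φ t O.merged mk Rb) hB.h0 hj
  have hLx := fun {k : ℕ} (hk : k ≤ Nx + 1) {j : ℕ} (hj : KS.j₀A t O.merged mk ≤ j) =>
    rootKit_levels Φ t O.merged mk ((Mu O.merged + 1 : ℕ) * (shearUnit (nL κ Φ t p O.merged (gOf κ Φ t p O gv) (fOf κ Φ t p O fv)) (hL κ Φ t p O.merged (gOf κ Φ t p O gv) (fOf κ Φ t p O fv)) : ℤ) + 1) (KS.r₀A Φ t O.merged mk (O.merged.R (O.merged.scale t (ML κ Φ t p O.merged (gOf κ Φ t p O gv)) (nL κ Φ t p O.merged (gOf κ Φ t p O gv) (fOf κ Φ t p O fv))))) (Finset.nonempty_Icc.1 (SN.nonempty k hk)) hj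
  have hLy := fun {k : ℕ} (hk : k ≤ Ny + 1) {j : ℕ} (hj : KS.j₀A t O.merged mk ≤ j) =>
    rootKit_levels Φ t O.merged mk ((Mu O.merged + 1 : ℕ) * (shearUnit (nL κ Φ t p O.merged (gOf κ Φ t p O gv) (fOf κ Φ t p O fv)) (hL κ Φ t p O.merged (gOf κ Φ t p O gv) (fOf κ Φ t p O fv)) : ℤ) + 1) (KS.r₀A Φ t O.merged mk (O.merged.R (O.merged.scale t (ML κ Φ t p O.merged (gOf κ Φ t p O gv)) (nL κ Φ t p O.merged (gOf κ Φ t p O gv) (fOf κ Φ t p O fv))))) (Finset.nonempty_Icc.1 (SY.nonempty k hk)) hj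
  have hEb : KS.j₁A κ Φ t p O.merged mk + (Pb.N * (tanOff Pb.ℓs Pb.M + 1) + Pb.N * Pb.d + KS.KCmax t O.merged mk) ≤ B.R' :=
    le_trans (rootKit_reach κ Φ t p O.merged mk _ _) hBR'
  have hEr : KS.j₁A κ Φ t p O.merged mk + (Pr.N * (tanOff Pr.ℓs Pr.M + 1) + Pr.N * Pr.d + KS.KCmax t O.merged mk) ≤ KS.RA' κ Φ t p O.merged mk :=
    rootKit_reach κ Φ t p O.merged mk _ _
  have hδkit : Neg.δkit κ Φ ≤ κ.δr (0 + 1 + Nx + 1 + Ny) := Neg.δkit_le_δr κ Φ hNr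
  obtain ⟨hk, hcount⟩ := KS.counts_R κ Φ t p O.merged mk hp0 hp1 hq1 hq2 hδkit
  have hkN : KS.kkA κ Φ t p O.merged mk * (Φ.Δ + 1) ^ (2 * KS.rsA Φ t O.merged mk) ≤ KS.NkA κ Φ t p O.merged mk :=
    KS.hNk_at κ Φ t p O.merged mk hp0 hp1
  have hδr : 0 < κ.δr (0 + 1 + Nx + 1 + Ny) := (κ.hδr _).1
  have hδI : Neg.δI κ Φ ≤ κ.δr (0 + 1 + Nx + 1 + Ny) ^ 2 := Neg.δI_le_sq_of_le κ Φ hδkit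
  have hδI' : Neg.δI κ Φ ≤ κ.δr (0 + 1 + Nx + 1 + Ny) := by
    have h1 : κ.δr (0 + 1 + Nx + 1 + Ny) ≤ 1 := (κ.hδr _).2
    have h2 : κ.δr (0 + 1 + Nx + 1 + Ny) ^ 2 ≤ κ.δr (0 + 1 + Nx + 1 + Ny) := by rw [sq]; exact mul_le_of_le_one_right hδr.le h1
    exact hδI.trans h2
  have hηδ : Neg.η κ Φ ≤ κ.δr (0 + 1 + Nx + 1 + Ny) / 2 := by linarith [(Neg.η_pos κ Φ).2.1, hδkit]
  obtain ⟨hnSK, hκSK, hℓSK⟩ := KS.pexXO_facts_of_atQOS (g := (gOf κ Φ t p O gv)) (f := (fOf κ Φ t p O fv)) mk hAtS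
  have hQKf := fun c => KS.QKO_facts κ Φ t p O.D O.DT O.ori (gOf κ Φ t p O gv) (fOf κ Φ t p O fv) mk c
  have hRgRs : ∀ c, (KS.QKO κ Φ t p O.D O.DT O.ori (gOf κ Φ t p O gv) (fOf κ Φ t p O fv) mk).RS c ≤ KS.Rs t O.merged mk := fun c => by rw [(hQKf c).2.2.2.1]; exact (KS.RK_le_Rs t O.merged mk).1
  have hRgcard : ∀ c, (RgO G (φL κ Φ t p O.D O.DT O.ori (gOf κ Φ t p O gv) (fOf κ Φ t p O fv)) (KS.QKO κ Φ t p O.D O.DT O.ori (gOf κ Φ t p O gv) (fOf κ Φ t p O fv) mk) c).card ≤ KS.cUA Φ t O.merged mk := fun c => by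
    rw [KS.RgO_QKO]; exact KS.card_RgK_le Φ t O.merged mk _ c
  have hcU1 := KS.hcU1_at Φ t O.merged mk
  have hkM : O.merged.k ≤ Mu O.merged := hkM₀
  have hkn : ∀ c, O.merged.Λ c O.merged.k ⊆ O.merged.Λ c (Mu O.merged) := fun c => by
    rw [hΛeq]; exact Skelφ.fatSeq_monotone Φ.frame hC c hkM
  have hZφ : ∀ c, (↑(O.merged.Λ c (Mu O.merged)) : Set V) ⊆ Skelφ.cyl Φ.φ c (Mu O.merged) := fun c => by
    rw [hΛeq]; exact Skelφ.fatSeq_subset_cyl Φ.frame hC c _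
  have hZ : ∀ c, (↑(O.merged.Λ c (Mu O.merged)) : Set V) ⊆ Skelφ.cyl (φL κ Φ t p O.D O.DT O.ori (gOf κ Φ t p O gv) (fOf κ Φ t p O fv)) c (Mu O.merged) := fun c => by
    unfold NegB.φL; rw [Skelφ.cyl_oriφ]; exact hZφ c
  have hΛ : ∀ c, ∀ v ∈ O.merged.Λ c (Mu O.merged), v ∈ RgO G (φL κ Φ t p O.D O.DT O.ori (gOf κ Φ t p O gv) (fOf κ Φ t p O fv)) (KS.QKO κ Φ t p O.D O.DT O.ori (gOf κ Φ t p O gv) (fOf κ Φ t p O fv) mk) c ∧ (φL κ Φ t p O.D O.DT O.ori (gOf κ Φ t p O gv) (fOf κ Φ t p O fv)) v - (φL κ Φ t p O.D O.DT O.ori (gOf κ Φ t p O gv) (fOf κ Φ t p O fv)) c ∈ box 2 (Mu O.merged) := fun c v hv => by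
    refine ⟨?_, ?_⟩
    · rw [KS.RgO_QKO]; exact hΛRg c hv
    · exact (Skelφ.mem_cyl (φ := (φL κ Φ t p O.D O.DT O.ori (gOf κ Φ t p O gv) (fOf κ Φ t p O fv))) c (Mu O.merged) v).1 (hZ c (Finset.mem_coe.2 hv))
  have hMz : Mu O.merged < (nL κ Φ t p O.merged (gOf κ Φ t p O gv) (fOf κ Φ t p O fv)) := lt_of_le_of_lt (Mu_le_ML κ Φ t p O.merged (gOf κ Φ t p O gv)) (ML_lt_nL κ Φ t p O.merged (gOf κ Φ t p O gv) (fOf κ Φ t p O fv)).1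
  have hzone : ∀ c, 1 - κ.δr (0 + 1 + Nx + 1 + Ny) ^ 2 < (bondPercolation G S.p).real (UniqZone.zone G (O.merged.Λ c) O.merged.k (Mu O.merged)) :=
    fun c => lt_of_le_of_lt (by linarith [hδI]) (zoneAt_of_atQOB hAtB h1 c)
  have hQ : ∀ c, (KS.QKO κ Φ t p O.D O.DT O.ori (gOf κ Φ t p O gv) (fOf κ Φ t p O fv) mk).nS c = KS.nKit O.merged mk ∧ (KS.QKO κ Φ t p O.D O.DT O.ori (gOf κ Φ t p O gv) (fOf κ Φ t p O fv) mk).hS c = O.merged.hgt t (KS.MK O.merged mk) (KS.nKit O.merged mk) ∧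
      (KS.QKO κ Φ t p O.D O.DT O.ori (gOf κ Φ t p O gv) (fOf κ Φ t p O fv) mk).ℓS c = O.merged.len t (KS.MK O.merged mk) (KS.nKit O.merged mk) ∧
      (KS.QKO κ Φ t p O.D O.DT O.ori (gOf κ Φ t p O gv) (fOf κ Φ t p O fv) mk).RS c = O.merged.R (O.merged.scale t (KS.MK O.merged mk) (KS.nKit O.merged mk)) ∧
      (KS.QKO κ Φ t p O.D O.DT O.ori (gOf κ Φ t p O gv) (fOf κ Φ t p O fv) mk).vS c = O.merged.spl t (KS.MK O.merged mk) (KS.nKit O.merged mk) := fun c => ⟨rfl, rfl, rfl, rfl, rfl⟩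
  have hservedK : ∀ (c : V) (fam : Fin 2) (σ' τ' : ℤˣ), 1 - κ.δr (0 + 1 + Nx + 1 + Ny) ^ 2 < (bondPercolation G q).real
      (linkIn (Skelφ.StepI.regionNAt G (oriφ (φL κ Φ t p O.D O.DT O.ori (gOf κ Φ t p O gv) (fOf κ Φ t p O fv)) ((KS.QKO κ Φ t p O.D O.DT O.ori (gOf κ Φ t p O gv) (fOf κ Φ t p O fv) mk).oS c)) O.merged t c (KS.MK O.merged mk) (KS.nKit O.merged mk))
        (O.merged.Λ c O.merged.k) (Skelφ.StepI.pieceNAt G (oriφ (φL κ Φ t p O.D O.DT O.ori (gOf κ Φ t p O gv) (fOf κ Φ t p O fv)) ((KS.QKO κ Φ t p O.D O.DT O.ori (gOf κ Φ t p O gv) (fOf κ Φ t p O fv) mk).oS c)) O.merged t c (KS.MK O.merged mk) (KS.nKit O.merged mk) fam σ' τ')) := by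
    intro c fam σ' τ'
    have h := inputsExtraAt_of_atQOB hAtB h1 c hPk fam σ' τ'
    rw [Skelφ.StepI.eventNAt_some] at h
    have hmap : oriφ (φL κ Φ t p O.D O.DT O.ori (gOf κ Φ t p O gv) (fOf κ Φ t p O fv)) ((KS.QKO κ Φ t p O.D O.DT O.ori (gOf κ Φ t p O gv) (fOf κ Φ t p O fv) mk).oS c) = oriφ Φ.φ (O.ori t (KS.MK O.merged mk) (KS.nKit O.merged mk)) := by
      rw [(hQKf c).2.2.2.2.2, KS.oriφ_φL_oS]; rfl
    rw [hmap]
    have h' : 1 - κ.δr (0 + 1 + Nx + 1 + Ny) ^ 2 ≤ 1 - Neg.δI κ Φ := by linarith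
    exact lt_of_le_of_lt h' h
  have hexitb := Skelφ.real_pexRO_gt (φ := (φL κ Φ t p O.D O.DT O.ori (gOf κ Φ t p O gv) (fOf κ Φ t p O fv))) (Λ := O.merged.Λ) (k := O.merged.k) hQ hservedK (Mu O.merged) Pb.A hσu
  have hexitr := Skelφ.real_pexXO_gt (φ := (φL κ Φ t p O.D O.DT O.ori (gOf κ Φ t p O gv) (fOf κ Φ t p O fv))) (Λ := O.merged.Λ) (k := O.merged.k) hQ hservedK (Mu O.merged) (nL κ Φ t p O.merged (gOf κ Φ t p O gv) (fOf κ Φ t p O fv)) (hL κ Φ t p O.merged (gOf κ Φ t p O gv) (fOf κ Φ t p O fv)) Pr.A hσu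
  have hexity := Skelφ.real_pexYO_gt (φ := (φL κ Φ t p O.D O.DT O.ori (gOf κ Φ t p O gv) (fOf κ Φ t p O fv))) (Λ := O.merged.Λ) (k := O.merged.k) hQ hservedK (Mu O.merged) (nL κ Φ t p O.merged (gOf κ Φ t p O gv) (fOf κ Φ t p O fv)) (hL κ Φ t p O.merged (gOf κ Φ t p O gv) (fOf κ Φ t p O fv)) Pr.A hσ
  have hlong : ∀ c (τ : ℤ), τ = 1 ∨ τ = -1 → 1 - κ.δr (0 + 1 + Nx + 1 + Ny) ^ 2 < (bondPercolation G S.p).real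
      (linkIn (Skelφ.pgramPrism G (φL κ Φ t p O.D O.DT O.ori (gOf κ Φ t p O gv) (fOf κ Φ t p O fv)) c (nL κ Φ t p O.merged (gOf κ Φ t p O gv) (fOf κ Φ t p O fv)) (hL κ Φ t p O.merged (gOf κ Φ t p O gv) (fOf κ Φ t p O fv)) (3 * (ℓL κ Φ t p O.merged (gOf κ Φ t p O gv) (fOf κ Φ t p O fv))) (O.merged.R (O.merged.scale t (ML κ Φ t p O.merged (gOf κ Φ t p O gv)) (nL κ Φ t p O.merged (gOf κ Φ t p O gv) (fOf κ Φ t p O fv))))) (O.merged.Λ c O.merged.k) (pgSideHalfW G (φL κ Φ t p O.D O.DT O.ori (gOf κ Φ t p O gv) (fOf κ Φ t p O fv)) c (nL κ Φ t p O.merged (gOf κ Φ t p O gv) (fOf κ Φ t p O fv)) (hL κ Φ t p O.merged (gOf κ Φ t p O gv) (fOf κ Φ t p O fv)) (ℓL κ Φ t p O.merged (gOf κ Φ t p O gv) (fOf κ Φ t p O fv)) (O.merged.R (O.merged.scale t (ML κ Φ t p O.merged (gOf κ Φ t p O gv)) (nL κ Φ t p O.merged (gOf κ Φ t p O gv) (fOf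 κ Φ t p O fv)))) σu (σu * τ))) := by
    intro c τ hτ
    have hστ : σu * τ = 1 ∨ σu * τ = -1 := by rcases hσu with h | h <;> rcases hτ with h' | h' <;> simp [h, h']
    have h := inputsLAt_of_atQOB hAtB h1 c 0 (Skelφ.sgnU σu) (Skelφ.sgnU (σu * τ))
    rw [Skelφ.StepI.eventNAt_some] at h
    unfold Skelφ.StepI.regionNAt Skelφ.StepI.pieceNAt at h
    rw [if_pos rfl, Skelφ.val_sgnU hσu, Skelφ.val_sgnU hστ] at h
    exact lt_of_le_of_lt (by linarith [hδI]) h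
  have hlongy : ∀ c (τ : ℤ), τ = 1 ∨ τ = -1 → 1 - κ.δr (0 + 1 + Nx + 1 + Ny) ^ 2 < (bondPercolation G S.p).real
      (linkIn (Skelφ.pgramPrism G (φL κ Φ t p O.D O.DT O.ori (gOf κ Φ t p O gv) (fOf κ Φ t p O fv)) c (nL κ Φ t p O.merged (gOf κ Φ t p O gv) (fOf κ Φ t p O fv)) (hL κ Φ t p O.merged (gOf κ Φ t p O gv) (fOf κ Φ t p O fv)) (3 * (ℓL κ Φ t p O.merged (gOf κ Φ t p O gv) (fOf κ Φ t p O fv))) (O.merged.R (O.merged.scale t (ML κ Φ t p O.merged (gOf κ Φ t p O gv)) (nL κ Φ t p O.merged (gOf κ Φ t p O gv) (fOf κ Φ t p O fv))))) (O.merged.Λ c O.merged.k) (pgTopPieceW G (φL κ Φ t p O.D O.DT O.ori (gOf κ Φ t p O gv) (fOf κ Φ t p O fv)) c (nL κ Φ t p O.merged (gOf κ Φ t p O gv) (fOf κ Φ t p O fv)) (hL κ Φ t p O.merged (gOf κ Φ t p O gv) (fOf κ Φ t p O fv)) (ℓL κ Φ t p O.merged (gOf κ Φ t p O gv) (fOf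 κ Φ t p O fv)) (O.merged.R (O.merged.scale t (ML κ Φ t p O.merged (gOf κ Φ t p O gv)) (nL κ Φ t p O.merged (gOf κ Φ t p O gv) (fOf κ Φ t p O fv)))) (sgOf du) τ (vL κ Φ t p O.merged (gOf κ Φ t p O gv) (fOf κ Φ t p O fv)))) := by
    intro c τ hτ
    have h := inputsLAt_of_atQOB hAtB h1 c 1 (Skelφ.sgnU (sgOf du)) (Skelφ.sgnU τ)
    rw [Skelφ.StepI.eventNAt_some] at h
    unfold Skelφ.StepI.regionNAt Skelφ.StepI.pieceNAt at h
    rw [if_neg (by decide), Skelφ.val_sgnU hσ, Skelφ.val_sgnU hτ] at h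
    exact lt_of_le_of_lt (by linarith [hδI]) h
  have hlink : 1 - κ.δr (0 + 1 + Nx + 1 + Ny) < (bondPercolation G S.p).real
      (linkIn (↑(pgramPrismFin G (φL κ Φ t p O.D O.DT O.ori (gOf κ Φ t p O gv) (fOf κ Φ t p O fv)) t (nL κ Φ t p O.merged (gOf κ Φ t p O gv) (fOf κ Φ t p O fv)) (hL κ Φ t p O.merged (gOf κ Φ t p O gv) (fOf κ Φ t p O fv)) (3 * (ℓL κ Φ t p O.merged (gOf κ Φ t p O gv) (fOf κ Φ t p O fv))) (O.merged.R (O.merged.scale t (ML κ Φ t p O.merged (gOf κ Φ t p O gv)) (nL κ Φ t p O.merged (gOf κ Φ t p O gv) (fOf κ Φ t p O fv))))) : Set V) A (pgSideHalfW G (φL κ Φ t p O.D O.DT O.ori (gOf κ Φ t p O gv) (fOf κ Φ t p O fv)) t (nL κ Φ t p O.merged (gOf κ Φ t p O gv) (fOf κ Φ t p O fv)) (hL κ Φ t p O.merged (gOf κ Φ t p O gv) (fOf κ Φ t p O fv)) (ℓL κ Φ t p O.merged (gOf κ Φ t p O gv) (fOf κ Φ t p O fv)) (O.merged.R (O.merged.scale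 t (ML κ Φ t p O.merged (gOf κ Φ t p O gv)) (nL κ Φ t p O.merged (gOf κ Φ t p O gv) (fOf κ Φ t p O fv)))) σu 1)) := by
    have h := inputsL_of_atQOS hAtS 0 (Skelφ.sgnU σu) 1
    rw [Skelφ.StepI.eventN_some] at h
    unfold Skelφ.StepI.regionN Skelφ.StepI.pieceN at h
    rw [if_pos rfl, Skelφ.val_sgnU hσu, Units.val_one] at h
    rw [Skelφ.StepI.coe_pgramPrismFin]
    exact lt_of_le_of_lt (by linarith [hδI']) h
  have hηδ' : @Neg.η κ V (fun a b => Classical.propDecidable (a = b)) _ G _ Φ ≤ κ.δr (0 + 1 + Nx + 1 + Ny) / 2 := by convert hηδ using 2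
  have hR₁ := hR₁_at κ Φ (mR κ Φ t p O.merged (gOf κ Φ t p O gv) (fOf κ Φ t p O fv) mx) hCq (oL κ Φ t p O.D O.DT O.ori (gOf κ Φ t p O gv) (fOf κ Φ t p O fv)) hηδ' t (Skelφ.fatRadius Φ.frame hC O.merged.k)
  exact Skelφ.rootOblTWAt_of_numbers6_y hlip hstep hfr hκc Φ.degree_le S hroot du hσu hAf hnL (hL κ Φ t p O.merged (gOf κ Φ t p O gv) (fOf κ Φ t p O fv)) hmf hc0 hc1 hDf hUfoot hMfoot htA hAconn hAρ hρπ hAQ hAφ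
    B hB hκL (ℓL κ Φ t p O.merged (gOf κ Φ t p O gv) (fOf κ Φ t p O fv)) (KS.RA' κ Φ t p O.merged mk) qX Nx (O.merged.R (O.merged.scale t (ML κ Φ t p O.merged (gOf κ Φ t p O gv)) (nL κ Φ t p O.merged (gOf κ Φ t p O gv) (fOf κ Φ t p O fv)))) cX hcX hcXπ' (abs_vL_le_of_atQOS hAtS) (layer_of_atQOS hAtS) qY Ny cY hcY hcYπ' hσ
    (KS.RlevA κ Φ t p O.merged mk) (KS.NkA κ Φ t p O.merged mk) (KS.j₀A t O.merged mk) (KS.j₁A κ Φ t p O.merged mk)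
    (KS.RlevA κ Φ t p O.merged mk) (KS.NkA κ Φ t p O.merged mk) (KS.j₀A t O.merged mk) (KS.j₁A κ Φ t p O.merged mk)
    (KS.RlevA κ Φ t p O.merged mk) (KS.NkA κ Φ t p O.merged mk) (KS.j₀A t O.merged mk) (KS.j₁A κ Φ t p O.merged mk)
    hRl₁ hRl₂ hRl₂ hj hj hj hB0 hRlπ hΛR hEqL.1.2.2.1 hΛQ0 hΛQ1 hkR0 hkR1 hfR0 hfR1 hprism hP0 hP1 hP2 hP3 hPf₁ hPf₂ hPf₃
    hregY hlastcY hQ0 hQ1 hQ2 hQ3 hQf₁ hQf₂ hQf₃ hL0 hL1 hL2 hL3 hLg₁ hLg₂ hLg₃ hxa hxb hclr hRn hclr₁ hπ1 hπ2 hclrY hx₂₃ hπ3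
    hδr hlink hcount hcount hcount (le_refl _) Pb Pr (le_trans (by norm_num) hPNb) rfl hd1b hD1b hD2b hDρb hℓb hWb (by simpa using hKmaxb) (by simpa using hKCmaxb) hR'b'
    (fun j hj _ => (hLb hj).1) (fun j hj _ => (hLb hj).2.1) (fun j hj _ => (hLb hj).2.2)
    hTb hT'b hr₀b hRb₀ hrsb hcSb hEb hreachb le_rfl hRbπ hPNr rfl hd1r hD1r hD2r hDρr hℓr hWr hKmaxr hKCmaxr hR'r' (fun k hk j hj _ => (hLx (by omega) hj).1) (fun k hk j hj _ => (hLx (by omega) hj).2.1)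
    (fun k hk j hj _ => (hLx (by omega) hj).2.2) (fun k hk j hj _ => (hLy (by omega) hj).1) (fun k hk j hj _ => (hLy (by omega) hj).2.1) (fun k hk j hj _ => (hLy (by omega) hj).2.2) hTr hT'r
    hr₀r hRr₀ hrsr hcSr hEr hEr hreachr le_rfl hRlπ (KS.QKO κ Φ t p O.D O.DT O.ori (gOf κ Φ t p O gv) (fOf κ Φ t p O fv) mk) hRgRs hRgcard hcU1 hnSK hκSK hℓSK hκL10 O.merged.Λ O.merged.k hkn hΛ hZ hMz hclrz Qb Fb hQb hFb hFZ
    (KS.kkA κ Φ t p O.merged mk) (KS.kkA κ Φ t p O.merged mk) (KS.kkA κ Φ t p O.merged mk) hkN hkN hkN hk hk hk hzone hexitb hexitr hexity hbridge hlong hlongy hUm hR₁ hR₁b hR₁r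

end AtQ

end NegB

end PlanarSkeletonNeg

end Summit.CriticalPhenomena.PercolationContinuityZ3.Theorems.Transplant

end
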